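import Mathlib.AlgebraicGeometry.EllipticCurve.Affine.Point
import Mathlib.RingTheory.Valuation.Integers
import Mathlib.RingTheory.Valuation.ValuationRing
import Mathlib.RingTheory.LocalRing.ResidueField.Basic
import Literature.NumberTheory.EllipticCurves.PointReduction
import HarnessLib

/-!
# Reduction of points modulo a valuation ring: `E₀(K)`, `E₁(K)`, the reduction homomorphism

(Silverman, *AEC* VII.2.1.)

Topic `EllipticCurves`.  Let `R` be a valuation ring of the field `K` — recorded, as in Mathlib's
`Valuation.Integers`, by a valuation `v : Valuation K Γ₀` and a proof `hv : v.Integers R`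
(`R → K` injective, `v ≤ 1` on `R`, and every element of valuation `≤ 1` comes from `R`); this
covers discrete valuation rings with their fraction field, `ValuationSubring`s, and the rings of
integers `v.adicCompletionIntegers K` of the completions of a number field — and let
`W : WeierstrassCurve R` be a Weierstrass equation with coefficients in `R` (an *integral*
Weierstrass equation for the curve `W.baseChange K` over `K`; minimality is not needed for
anything in this file).  Write `W̃ = W.map (IsLocalRing.residue R)` for the reduced equation over
the residue field `k`, a possibly singular Weierstrass cubic, and `Ẽ_ns(k)` for its group of
nonsingular points, which **is** Mathlib's `W̃.toAffine.Point` with its group law (Mathlib's group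
law on `WeierstrassCurve.Affine.Point` is stated and proved for every Weierstrass cubic over a
field; this is *AEC* III.2.5).

Following Silverman, *The Arithmetic of Elliptic Curves*, VII.2 (PDF pp. 166–169 of the held 2nd
edition), this file defines

* `WeierstrassCurve.reducePoint W P : W̃.toAffine.Point` — the reduction `P̃` of a `K`-point `P`
  (`O ↦ Õ`; `(x, y) ↦ Õ` if `x ∉ R`; `(x, y) ↦ (x̄, ȳ)` if `x, y ∈ R` and `(x̄, ȳ)` is nonsingular
  on `W̃`; junk value `Õ` on points with singular reduction);
* `WeierstrassCurve.ReducesToZero W P` — `P ∈ E₁(K)`, "the kernel of reduction":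
  `P = O` or `x(P) ∉ R`;
* `WeierstrassCurve.HasNonsingularReduction W P` — `P ∈ E₀(K)`, "the set of points with
  nonsingular reduction" (same shape as `WeierstrassCurve.IsNonsingularReductionPoint` of
  `Tamagawa.lean`, which is the special case of a discrete valuation ring and Mathlib's
  `W.reduction`);

and proves the algebraic content of *AEC* Prop. VII.2.1 in this generality:

* `WeierstrassCurve.ReducesToZero.add`, `.neg` — `E₁(K)` is a subgroup
  (`WeierstrassCurve.kernelOfReduction W hv : AddSubgroup _`);
* `WeierstrassCurve.HasNonsingularReduction.add`, `.neg` — `E₀(K)` is a subgroup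
  (`WeierstrassCurve.nonsingularReductionSubgroup W hv`);
* `WeierstrassCurve.reducePoint_add`, `reducePoint_neg` — reduction is a homomorphism on `E₀(K)`
  (`WeierstrassCurve.reductionHom W hv : E₀(K) →+ Ẽ_ns(k)`);
* `WeierstrassCurve.reducePoint_eq_zero_iff`, `reductionHom_ker` — its kernel is `E₁(K)`,
  i.e. exactness of `0 → E₁(K) → E₀(K) → Ẽ_ns(k)`.

The *surjectivity* of `E₀(K) → Ẽ_ns(k)` in VII.2.1 uses Hensel's lemma for a complete (or
henselian) `R` and is **not** treated here.

## Relation to the tree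

This is the general form (arbitrary valuation ring and value group, singular reduction allowed,
including the case `P̃ = Q̃ = Õ`) of three earlier, special-purpose treatments, to which it is
wired by the bridge lemmas at the end of the file and by the sibling `TamagawaProofs`:

* `PointReduction.lean` (`Literature.reducePoint w r Ṽ`, `Literature.IsIntegralPoint w`, `Literature.NumberTheory.EllipticCurves.reducePoint_add`,
  `Literature.NumberTheory.EllipticCurves.reduceHom`; valuations `w : Valuation L ℝ≥0`, *good reduction* `w Δ = 1`, reduction on the
  integral points only): `WeierstrassCurve.reducesToZero_iff_not_isIntegralPoint`
  (`E₁(L) ∖ {O} = ` the non-integral points) and `WeierstrassCurve.reducePoint_eq_reducePoint`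
  (for `r` the residue map and `Ṽ = W.map r` the two reduction maps agree on every point);
  its inputs from `GoodReductionInertia.lean` are special cases of lemmas here:
  `Literature.NumberTheory.EllipticCurves.val_y_le_one` ~ `Literature.NumberTheory.EllipticCurves.v_Y_le_one_of_v_X_le_one`, `Literature.NumberTheory.EllipticCurves.add_eq_zero_or_one_lt_val` (needs
  `w Δ = 1`) ~ `WeierstrassCurve.reducesToZero_add_of_residue_eq`, `Literature.NumberTheory.EllipticCurves.val_addX_le_one_of_one_lt`
  ~ `WeierstrassCurve.exists_add_eq_of_one_lt_aux`; conversely `Literature.NumberTheory.EllipticCurves.val_le_one_of_zsmul_eq_zero`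
  there (prime-to-`p` torsion is integral, i.e. `E₁` has no prime-to-`p` torsion, *AEC* VII.3.1)
  is not reproved here.
* `FormalGroup.lean`: `WeierstrassCurve.IsInReductionKernel` is `E₁(ℚ_p) ∖ {O}` for `ℤ_[p]`-models
  (`v x < 0` additively), the `p`-adic special case of `WeierstrassCurve.ReducesToZero`.
* `Tamagawa.lean`: `WeierstrassCurve.IsNonsingularReductionPoint R W` (`E₀` for a discrete
  valuation ring `R`, `W` over `K` minimal, Mathlib's `W.reduction R`) and the named fact
  `WeierstrassCurve.mem_goodReductionSubgroup_iff` ("`E₀(K)` is a subgroup"), which is exactly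
  `HasNonsingularReduction.add/.neg` here; the identification
  `(W₀.baseChange K).IsNonsingularReductionPoint R P ↔ W₀.HasNonsingularReduction P` and the
  discharge `mem_goodReductionSubgroup_iff_holds` are in the sibling proof file `TamagawaProofs`.

## Proof

Silverman proves two of the cases via intersection multiplicities of lines with the cubic and
leaves the others to the reader (Exercise 7.15).  The proof here is by the same case distinction
on the reduced points, carried out on Mathlib's explicit chord–tangent formulas
(`WeierstrassCurve.Affine.addX/addY/slope`, `Point.add_some`, `addPolynomial_slope`) with
valuation estimates, as follows (`P = (x₁, y₁)`, `Q = (x₂, y₂)`, `x₃ = x(P + Q)`).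

* `P̃ = Q̃ = Õ` (`Literature.NumberTheory.EllipticCurves.one_lt_v_addX_of_one_lt`): in the chart `z = -x/y`, `w = -1/y` at `O`
  (the chart of the formal group, *AEC* IV.1) the chord satisfies `(w₁ - w₂) B = (z₁ - z₂) A`
  with `B` a unit and `v(A) ≤ max(v z₁, v z₂)²` (`Literature.NumberTheory.EllipticCurves.WeierstrassCurve.Affine.zw_chord`), which
  bounds the `Y`-intercept `c` of the line `PQ` from below (`chord_intercept_mul`:
  `c (B w₁ - A z₁) = -B`); the constant term of the chord cubic gives `x₁ x₂ x₃ = c² + a₃ c - a₆`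
  (`X_mul_X_mul_addX_slope`, from Mathlib's `addPolynomial_slope`), whence `v(x₃) > 1`.  The
  tangent case uses `c (y - (-y - a₁x - a₃)) = -(y² + a₁xy + 2a₃y - a₂x² - 2a₄x - 3a₆)` instead.
* `P̃ = Õ ≠ Q̃` (`exists_add_eq_of_one_lt`): `(x₃ - x₂)(x₁ - x₂)² = 3x₁x₂² - x₂³ + 2a₂x₁x₂ +
  a₄(x₁ + x₂) + 2a₆ - a₁(x₁y₂ + x₂y₁) - a₃(y₁ + y₂) - 2y₁y₂` gives `x̄₃ = x̄₂`; that moreover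
  `ȳ₃ = ȳ₂` (and not `-ȳ₂ - ã₁x̄₂ - ã₃`) is deduced from the group law: otherwise
  `(P + Q)~ = -Q̃`, so `(P + Q) + Q ∈ E₁(K)` by the last case below and `2Q = ((P + Q) + Q) - P ∈
  E₁(K)`, contradicting the next case applied to `Q + Q`.
* `P̃, Q̃ ≠ Õ`, `x̄₁ ≠ x̄₂` or `P̃ = Q̃ ≠ -Q̃` (`exists_add_eq_of_residue_ne`,
  `exists_add_eq_of_residue_eq`): the slope is the image of an element `L ∈ R` whose residue is
  the slope of `P̃Q̃`, resp. of the tangent at `P̃` — in the second case by *AEC* Lemma VII.2.1.1,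
  here in the explicit form `λ = N/D`, `(y₁ - y₂) D = (x₁ - x₂) N` with
  `D = y₁ + y₂ + a₁x₁ + a₃` a unit — and then `(P + Q)~ = P̃ + Q̃` because the addition formulas
  commute with ring homomorphisms (Mathlib `map_addX`, `map_addY`).
* `P̃ = -Q̃ ≠ Õ` (`reducesToZero_add_of_residue_eq`): the slope has valuation `> 1`
  (at a point of order `2` of `Ẽ_ns` because `∂f̃/∂y = 0` forces `∂f̃/∂x ≠ 0`), hence so does
  `x₃ = λ² + a₁λ - a₂ - x₁ - x₂`.

## References

* J. H. Silverman, *The Arithmetic of Elliptic Curves*, 2nd ed., GTM 106, Springer 2009,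
  VII.2 "Reduction modulo π", Prop. VII.2.1 and Lemma VII.2.1.1 (PDF pp. 166–169 of the held copy),
  Exercise 7.15. [SilvermanAEC2009]

## Design

* The definitions depend only on the local ring `R` and `W : WeierstrassCurve R` (membership in
  `R` is `x ∈ Set.range (algebraMap R K)`); the valuation enters the theorems through
  `hv : v.Integers R`, and the bundled subgroups/homomorphism take `hv` as an argument.
* Deliberate dot-notation extensions of Mathlib's `WeierstrassCurve` namespace for the
  definitions and main theorems; auxiliary identities and valuation lemmas are in `namespace Literature`
  (`Literature.WeierstrassCurve.Affine.*` for identities about Mathlib's `addX`/`slope`).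
* `noncomputable section`, `open scoped Classical` (Mathlib's group law on `Affine.Point` needs
  `DecidableEq` on the field).
-/

noncomputable section

open scoped Classical

namespace Literature.NumberTheory.EllipticCurves

/-! ### Algebraic identities for the chord–tangent law -/

namespace WeierstrassCurve.Affine

variable {F : Type*} [Field F] (W : WeierstrassCurve.Affine F)

/-- Symmetric form of the `X`-coordinate of a chord sum: `x₃ (x₁ - x₂)² = x₁²x₂ + x₁x₂² + 2a₂x₁x₂
+ a₄(x₁ + x₂) + 2a₆ - a₁(x₁y₂ + x₂y₁) - a₃(y₁ + y₂) - 2y₁y₂`. [folklore] -/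
theorem addX_slope_mul_sub_sq {x₁ x₂ y₁ y₂ : F} (h₁ : W.Equation x₁ y₁) (h₂ : W.Equation x₂ y₂)
    (hx : x₁ ≠ x₂) :
    W.addX x₁ x₂ (W.slope x₁ x₂ y₁ y₂) * (x₁ - x₂) ^ 2 =
      x₁ ^ 2 * x₂ + x₁ * x₂ ^ 2 + 2 * W.a₂ * x₁ * x₂ + W.a₄ * (x₁ + x₂) + 2 * W.a₆
        - W.a₁ * (x₁ * y₂ + x₂ * y₁) - W.a₃ * (y₁ + y₂) - 2 * y₁ * y₂ := by
  rw [WeierstrassCurve.Affine.equation_iff] at h₁ h₂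
  rw [WeierstrassCurve.Affine.slope_of_X_ne hx, WeierstrassCurve.Affine.addX]
  have hx' : x₁ - x₂ ≠ 0 := sub_ne_zero.mpr hx
  field_simp
  linear_combination h₁ + h₂

/-- `(y₁ - y₂)(y₁ + y₂ + a₁x₁ + a₃) = (x₁ - x₂)(x₁² + x₁x₂ + x₂² + a₂(x₁ + x₂) + a₄ - a₁y₂)`.
[folklore] -/
theorem Y_sub_mul_eq_X_sub_mul {x₁ x₂ y₁ y₂ : F} (h₁ : W.Equation x₁ y₁) (h₂ : W.Equation x₂ y₂) :
    (y₁ - y₂) * (y₁ + y₂ + W.a₁ * x₁ + W.a₃) =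
      (x₁ - x₂) * (x₁ ^ 2 + x₁ * x₂ + x₂ ^ 2 + W.a₂ * (x₁ + x₂) + W.a₄ - W.a₁ * y₂) := by
  rw [WeierstrassCurve.Affine.equation_iff] at h₁ h₂
  linear_combination h₁ - h₂

/-- Constant term of the chord/tangent cubic (Mathlib `addPolynomial_slope` at `X = 0`):
`x₁ x₂ x₃ = c² + a₃ c - a₆` with `c = y₁ - λ x₁` the `Y`-intercept of the line. [folklore] -/
theorem X_mul_X_mul_addX_slope {x₁ x₂ y₁ y₂ : F} (h₁ : W.Equation x₁ y₁) (h₂ : W.Equation x₂ y₂)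
    (hxy : ¬(x₁ = x₂ ∧ y₁ = W.negY x₂ y₂)) :
    x₁ * x₂ * W.addX x₁ x₂ (W.slope x₁ x₂ y₁ y₂) =
      (y₁ - W.slope x₁ x₂ y₁ y₂ * x₁) ^ 2 + W.a₃ * (y₁ - W.slope x₁ x₂ y₁ y₂ * x₁) - W.a₆ := by
  have key := congrArg (Polynomial.eval 0) (WeierstrassCurve.Affine.addPolynomial_slope h₁ h₂ hxy)
  rw [WeierstrassCurve.Affine.addPolynomial_eq] at key
  simp only [Cubic.toPoly, Polynomial.eval_neg, Polynomial.eval_add, Polynomial.eval_mul,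
    Polynomial.eval_pow, Polynomial.eval_C, Polynomial.eval_X, Polynomial.eval_sub] at key
  linear_combination -key

/-- The `Y`-intercept of the tangent line: `(y - λ x)(y - (-y - a₁x - a₃)) =
-(y² + a₁xy + 2a₃y - a₂x² - 2a₄x - 3a₆)`. [folklore] -/
theorem Y_sub_slope_mul_X_mul {x y : F} (h : W.Equation x y) (hy : y ≠ W.negY x y) :
    (y - W.slope x x y y * x) * (y - W.negY x y) =
      -(y ^ 2 + W.a₁ * x * y + 2 * W.a₃ * y - W.a₂ * x ^ 2 - 2 * W.a₄ * x - 3 * W.a₆) := by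
  rw [WeierstrassCurve.Affine.equation_iff] at h
  rw [WeierstrassCurve.Affine.slope_of_Y_ne rfl hy]
  have hy' : y - W.negY x y ≠ 0 := sub_ne_zero.mpr hy
  field_simp
  rw [WeierstrassCurve.Affine.negY]
  linear_combination 3 * h

/-- The Weierstrass equation in the chart `z = -x/y`, `w = -1/y` at `O` (Silverman, *AEC* IV.1):
`w = z³ + a₁zw + a₂z²w + a₃w² + a₄zw² + a₆w³`. [cite: SilvermanAEC2009, IV.1 (PDF p. 109)] -/
theorem equation_zw {x y : F} (h : W.Equation x y) (hy : y ≠ 0) :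
    (-1 / y) = (-x / y) ^ 3 + W.a₁ * (-x / y) * (-1 / y) + W.a₂ * (-x / y) ^ 2 * (-1 / y)
      + W.a₃ * (-1 / y) ^ 2 + W.a₄ * (-x / y) * (-1 / y) ^ 2 + W.a₆ * (-1 / y) ^ 3 := by
  rw [WeierstrassCurve.Affine.equation_iff] at h
  field_simp
  linear_combination -h

/-- The chord through two points of the `(z, w)`-curve: `(w₁ - w₂) B = (z₁ - z₂) A` with
`A = z₁² + z₁z₂ + z₂² + a₁w₁ + a₂(z₁ + z₂)w₁ + a₄w₁²` and
`B = 1 - a₁z₂ - a₂z₂² - a₃(w₁ + w₂) - a₄z₂(w₁ + w₂) - a₆(w₁² + w₁w₂ + w₂²)` (the computation of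
the slope `λ = (w₂ - w₁)/(z₂ - z₁)` of Silverman, *AEC* IV.1, PDF p. 111, done exactly).
[cite: SilvermanAEC2009, IV.1 (PDF pp. 109, 111)] -/
theorem zw_chord {z₁ w₁ z₂ w₂ a₁ a₂ a₃ a₄ a₆ : F}
    (h₁ : w₁ = z₁ ^ 3 + a₁ * z₁ * w₁ + a₂ * z₁ ^ 2 * w₁ + a₃ * w₁ ^ 2 + a₄ * z₁ * w₁ ^ 2
      + a₆ * w₁ ^ 3)
    (h₂ : w₂ = z₂ ^ 3 + a₁ * z₂ * w₂ + a₂ * z₂ ^ 2 * w₂ + a₃ * w₂ ^ 2 + a₄ * z₂ * w₂ ^ 2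
      + a₆ * w₂ ^ 3) :
    (w₁ - w₂) * (1 - a₁ * z₂ - a₂ * z₂ ^ 2 - a₃ * (w₁ + w₂) - a₄ * z₂ * (w₁ + w₂)
        - a₆ * (w₁ ^ 2 + w₁ * w₂ + w₂ ^ 2)) =
      (z₁ - z₂) * (z₁ ^ 2 + z₁ * z₂ + z₂ ^ 2 + a₁ * w₁ + a₂ * (z₁ + z₂) * w₁ + a₄ * w₁ ^ 2) := by
  linear_combination h₁ - h₂

/-- The `Y`-intercept `c = y₁ - λ x₁` of a chord, in the `(z, w)`-chart:
`c · (B w₁ - A z₁) = -B`. [folklore] -/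
theorem chord_intercept_mul {x₁ x₂ y₁ y₂ A B : F} (hy₁ : y₁ ≠ 0) (hy₂ : y₂ ≠ 0) (hx : x₁ ≠ x₂)
    (hAB : (-1 / y₁ - -1 / y₂) * B = (-x₁ / y₁ - -x₂ / y₂) * A) :
    (y₁ - (y₁ - y₂) / (x₁ - x₂) * x₁) * (B * (-1 / y₁) - A * (-x₁ / y₁)) = -B := by
  have hx' : x₁ - x₂ ≠ 0 := sub_ne_zero.mpr hx
  field_simp at hAB
  field_simp
  linear_combination x₁ * hAB

end WeierstrassCurve.Affine

/-- Two affine points with the same coordinates are equal. [folklore] -/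
theorem point_some_congr {F : Type*} [CommRing F] {V : WeierstrassCurve.Affine F} {x y x' y' : F}
    (hx : x = x') (hy : y = y') {h : V.Nonsingular x y} {h' : V.Nonsingular x' y'} :
    WeierstrassCurve.Affine.Point.some x y h = .some x' y' h' := by
  subst hx hy; rfl

/-! ### Valuation rings: integrality and units -/

section Valuation

variable {K : Type*} [Field K] {Γ₀ : Type*} [LinearOrderedCommGroupWithZero Γ₀]
  {v : Valuation K Γ₀} {R : Type*} [CommRing R] [Algebra R K]

/-- `x ∈ R ↔ v x ≤ 1`. [folklore] -/
theorem exists_algebraMap_eq_iff (hv : v.Integers R) {x : K} :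
    (∃ a : R, algebraMap R K a = x) ↔ v x ≤ 1 :=
  ⟨fun ⟨a, ha⟩ ↦ ha ▸ hv.map_le_one a, fun h ↦ hv.exists_of_le_one h⟩

/-- `x ∉ R ↔ 1 < v x`. [folklore] -/
theorem not_mem_range_iff (hv : v.Integers R) {x : K} :
    x ∉ Set.range (algebraMap R K) ↔ 1 < v x := by
  rw [Set.mem_range, exists_algebraMap_eq_iff hv, not_le]

/-- The hypothesis `hv : v.Integers R` of this file for a valuation ring `R` with fraction field `K`
(e.g. a discrete valuation ring) and its canonical valuation `ValuationRing.valuation R K`.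
[folklore] -/
theorem integers_valuationRing_valuation (R : Type*) (K : Type*) [CommRing R] [IsDomain R]
    [ValuationRing R] [Field K] [Algebra R K] [IsFractionRing R K] :
    (ValuationRing.valuation R K).Integers R :=
  ⟨IsFractionRing.injective R K,
    fun a ↦ (ValuationRing.mem_integer_iff R K (algebraMap R K a)).mpr ⟨a, rfl⟩,
    fun x hx ↦ (ValuationRing.mem_integer_iff R K x).mp hx⟩

end Valuation

section LocalRing

variable {K : Type*} [Field K] {Γ₀ : Type*} [LinearOrderedCommGroupWithZero Γ₀]
  {v : Valuation K Γ₀} {R : Type*} [CommRing R] [IsLocalRing R] [Algebra R K]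
  {W : WeierstrassCurve R}

/-- An element of `R` has valuation `< 1` iff it reduces to `0`. [folklore] -/
theorem v_algebraMap_lt_one_iff (hv : v.Integers R) (a : R) :
    v (algebraMap R K a) < 1 ↔ IsLocalRing.residue R a = 0 := by
  rw [IsLocalRing.residue_eq_zero_iff, IsLocalRing.mem_maximalIdeal, mem_nonunits_iff,
    hv.isUnit_iff_valuation_eq_one]
  exact ⟨fun h ↦ h.ne, fun h ↦ lt_of_le_of_ne (hv.map_le_one a) h⟩

/-- An element of `R` has valuation `1` iff its residue is non-zero. [folklore] -/
theorem v_algebraMap_eq_one_iff (hv : v.Integers R) (a : R) :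
    v (algebraMap R K a) = 1 ↔ IsLocalRing.residue R a ≠ 0 := by
  rw [Ne, ← v_algebraMap_lt_one_iff hv, not_lt]
  exact ⟨fun h ↦ h.ge, fun h ↦ le_antisymm (hv.map_le_one a) h⟩

/-- An element of a local ring with non-zero residue is a unit. [folklore] -/
theorem isUnit_of_residue_ne_zero {a : R} (h : IsLocalRing.residue R a ≠ 0) : IsUnit a := by
  rwa [Ne, IsLocalRing.residue_eq_zero_iff, IsLocalRing.mem_maximalIdeal, mem_nonunits_iff,
    not_not] at h

/-- `negY` commutes with reduction of the coefficients. [folklore] -/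
theorem map_residue_negY (a b : R) :
    (W.map (IsLocalRing.residue R)).toAffine.negY (IsLocalRing.residue R a)
        (IsLocalRing.residue R b) = IsLocalRing.residue R (W.toAffine.negY a b) := by
  simp only [WeierstrassCurve.Affine.negY, WeierstrassCurve.map_a₁, WeierstrassCurve.map_a₃,
    map_sub, map_neg, map_mul]

/-- The partial derivatives of the reduced equation at `(ā, b̄)`, as residues. [folklore] -/
theorem residue_polynomialY (a b : R) :
    IsLocalRing.residue R (b - W.toAffine.negY a b) =
      (W.map (IsLocalRing.residue R)).toAffine.polynomialY.evalEval (IsLocalRing.residue R a)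
        (IsLocalRing.residue R b) := by
  rw [WeierstrassCurve.Affine.evalEval_polynomialY, WeierstrassCurve.Affine.negY]
  simp only [map_sub, map_neg, map_mul, WeierstrassCurve.map_a₁, WeierstrassCurve.map_a₃]
  ring

/-- `∂f̃/∂x` at `(ā, b̄)` as a residue. [folklore] -/
theorem residue_polynomialX (a b : R) :
    IsLocalRing.residue R (3 * a ^ 2 + 2 * W.a₂ * a + W.a₄ - W.a₁ * b) =
      -(W.map (IsLocalRing.residue R)).toAffine.polynomialX.evalEval (IsLocalRing.residue R a)
        (IsLocalRing.residue R b) := by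
  rw [WeierstrassCurve.Affine.evalEval_polynomialX]
  simp only [map_sub, map_add, map_mul, map_pow, map_ofNat, WeierstrassCurve.map_a₁,
    WeierstrassCurve.map_a₂, WeierstrassCurve.map_a₄]
  ring

/-- At a nonsingular point of the reduction where `∂/∂y` vanishes, `∂/∂x` does not. [folklore] -/
theorem residue_ne_zero_of_residue_eq_zero {a b : R}
    (hns : (W.map (IsLocalRing.residue R)).toAffine.Nonsingular (IsLocalRing.residue R a)
      (IsLocalRing.residue R b))
    (hD : IsLocalRing.residue R (b - W.toAffine.negY a b) = 0) :
    IsLocalRing.residue R (3 * a ^ 2 + 2 * W.a₂ * a + W.a₄ - W.a₁ * b) ≠ 0 := by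
  rw [residue_polynomialX, neg_ne_zero]
  rw [residue_polynomialY] at hD
  exact hns.2.resolve_right (fun h ↦ h hD)

end LocalRing

/-! ### Valuations of the coordinates of a point -/

section Coordinates

variable {K : Type*} [Field K] {Γ₀ : Type*} [LinearOrderedCommGroupWithZero Γ₀]
  {v : Valuation K Γ₀} {R : Type*} [CommRing R] [Algebra R K]
  {W : WeierstrassCurve R}

/-- An affine point with integral `x`-coordinate has integral `y`-coordinate.
[cite: SilvermanAEC2009, VII.2 (PDF p. 170: "v(x) < 0 and v(y) < 0")] -/
theorem v_Y_le_one_of_v_X_le_one (hv : v.Integers R) {x y : K}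
    (h : (W.baseChange K).toAffine.Equation x y) (hx : v x ≤ 1) : v y ≤ 1 := by
  by_contra hy
  rw [not_le] at hy
  rw [WeierstrassCurve.Affine.equation_iff] at h
  simp only [WeierstrassCurve.baseChange, WeierstrassCurve.map_a₁, WeierstrassCurve.map_a₂,
    WeierstrassCurve.map_a₃, WeierstrassCurve.map_a₄, WeierstrassCurve.map_a₆] at h
  have h1 := hv.map_le_one
  -- valuation of the right-hand side is `≤ 1`
  have hR : v (algebraMap R K W.a₂ * x ^ 2 + algebraMap R K W.a₄ * x + algebraMap R K W.a₆
      + x ^ 3) ≤ 1 := by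
    refine v.map_add_le (v.map_add_le (v.map_add_le ?_ ?_) (h1 _)) ?_
    · rw [map_mul, map_pow]
      exact mul_le_one' (h1 _) (pow_le_one₀ zero_le hx)
    · rw [map_mul]
      exact mul_le_one' (h1 _) hx
    · rw [map_pow]
      exact pow_le_one₀ zero_le hx
  -- valuation of the left-hand side is `v y ^ 2 > 1`
  have hL : v ((algebraMap R K W.a₁ * x + algebraMap R K W.a₃) * y) < v (y ^ 2) := by
    rw [map_mul, map_pow, sq]
    have hc : v (algebraMap R K W.a₁ * x + algebraMap R K W.a₃) ≤ 1 :=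
      v.map_add_le (by rw [map_mul]; exact mul_le_one' (h1 _) hx) (h1 _)
    calc v (algebraMap R K W.a₁ * x + algebraMap R K W.a₃) * v y ≤ 1 * v y := by gcongr
      _ < v y * v y := mul_lt_mul_of_pos_right hy (lt_trans zero_lt_one hy)
  have key : v (y ^ 2 + (algebraMap R K W.a₁ * x + algebraMap R K W.a₃) * y) = v (y ^ 2) :=
    v.map_add_eq_of_lt_left hL
  have : y ^ 2 + (algebraMap R K W.a₁ * x + algebraMap R K W.a₃) * y =
      algebraMap R K W.a₂ * x ^ 2 + algebraMap R K W.a₄ * x + algebraMap R K W.a₆ + x ^ 3 := by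
    linear_combination h
  rw [this] at key
  have : (1 : Γ₀) < v (y ^ 2) := by
    rw [map_pow]; exact one_lt_pow₀ hy two_ne_zero
  exact (key ▸ hR).not_gt this

/-- For an affine point with non-integral `x`-coordinate (`1 < v x`): `v x < v y` and
`v y ^ 2 = v x ^ 3`.
[cite: SilvermanAEC2009, VII.2 Prop. 2.2, proof (PDF p. 170: "3v(x) = 2v(y)")] -/
theorem v_X_lt_v_Y_of_one_lt (hv : v.Integers R) {x y : K}
    (h : (W.baseChange K).toAffine.Equation x y) (hx : 1 < v x) :
    v x < v y ∧ v y ^ 2 = v x ^ 3 := by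
  rw [WeierstrassCurve.Affine.equation_iff] at h
  simp only [WeierstrassCurve.baseChange, WeierstrassCurve.map_a₁, WeierstrassCurve.map_a₂,
    WeierstrassCurve.map_a₃, WeierstrassCurve.map_a₄, WeierstrassCurve.map_a₆] at h
  have h1 := hv.map_le_one
  have hx0 : (0 : Γ₀) < v x := lt_trans zero_lt_one hx
  have hx1 : (1 : Γ₀) ≤ v x := hx.le
  -- the right-hand side has valuation `v x ^ 3`
  have hlow : v (algebraMap R K W.a₂ * x ^ 2 + algebraMap R K W.a₄ * x + algebraMap R K W.a₆)
      < v (x ^ 3) := by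
    have hx2 : v x ^ 2 < v x ^ 3 := pow_lt_pow_right₀ hx (by norm_num)
    rw [map_pow]
    refine v.map_add_lt (v.map_add_lt ?_ ?_) ?_
    · rw [map_mul, map_pow]
      calc v (algebraMap R K W.a₂) * v x ^ 2 ≤ 1 * v x ^ 2 := by gcongr; exact h1 _
        _ = v x ^ 2 := one_mul _
        _ < v x ^ 3 := hx2
    · rw [map_mul]
      calc v (algebraMap R K W.a₄) * v x ≤ 1 * v x := by gcongr; exact h1 _
        _ = v x ^ 1 := by simp
        _ < v x ^ 3 := pow_lt_pow_right₀ hx (by norm_num)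
    · calc v (algebraMap R K W.a₆) ≤ 1 := h1 _
        _ = v x ^ 0 := by simp
        _ < v x ^ 3 := pow_lt_pow_right₀ hx (by norm_num)
  have hR : v (x ^ 3 + (algebraMap R K W.a₂ * x ^ 2 + algebraMap R K W.a₄ * x
      + algebraMap R K W.a₆)) = v x ^ 3 := by
    rw [v.map_add_eq_of_lt_left hlow, map_pow]
  have heq : y ^ 2 + (algebraMap R K W.a₁ * x + algebraMap R K W.a₃) * y =
      x ^ 3 + (algebraMap R K W.a₂ * x ^ 2 + algebraMap R K W.a₄ * x + algebraMap R K W.a₆) := by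
    linear_combination h
  have hcoef : v (algebraMap R K W.a₁ * x + algebraMap R K W.a₃) ≤ v x := by
    refine v.map_add_le ?_ ((h1 _).trans hx1)
    rw [map_mul]
    calc v (algebraMap R K W.a₁) * v x ≤ 1 * v x := by gcongr; exact h1 _
      _ = v x := one_mul _
  -- first `v x < v y`
  have hxy : v x < v y := by
    by_contra hyx
    rw [not_lt] at hyx
    have hL : v (y ^ 2 + (algebraMap R K W.a₁ * x + algebraMap R K W.a₃) * y) < v x ^ 3 := by
      have hx2 : v x ^ 2 < v x ^ 3 := pow_lt_pow_right₀ hx (by norm_num)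
      refine v.map_add_lt ?_ ?_
      · rw [map_pow]
        exact (pow_le_pow_left₀ zero_le hyx 2).trans_lt hx2
      · rw [map_mul]
        calc v (algebraMap R K W.a₁ * x + algebraMap R K W.a₃) * v y ≤ v x * v x := by gcongr
          _ = v x ^ 2 := (sq _).symm
          _ < v x ^ 3 := hx2
    rw [heq, hR] at hL
    exact lt_irrefl _ hL
  refine ⟨hxy, ?_⟩
  have hy0 : (0 : Γ₀) < v y := hx0.trans hxy
  have hL : v ((algebraMap R K W.a₁ * x + algebraMap R K W.a₃) * y) < v (y ^ 2) := by
    rw [map_mul, map_pow, sq]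
    calc v (algebraMap R K W.a₁ * x + algebraMap R K W.a₃) * v y ≤ v x * v y := by gcongr
      _ < v y * v y := mul_lt_mul_of_pos_right hxy hy0
  have key : v (y ^ 2 + (algebraMap R K W.a₁ * x + algebraMap R K W.a₃) * y) = v y ^ 2 := by
    rw [v.map_add_eq_of_lt_left hL, map_pow]
  rw [← key, heq, hR]

/-- Consequences: `1 < v y`, `v y < v x ^ 2`. [folklore] -/
theorem v_Y_lt_v_X_sq_of_one_lt (hv : v.Integers R) {x y : K}
    (h : (W.baseChange K).toAffine.Equation x y) (hx : 1 < v x) : v y < v x ^ 2 := by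
  obtain ⟨hxy, hsq⟩ := v_X_lt_v_Y_of_one_lt hv h hx
  by_contra hle
  rw [not_lt] at hle
  have : v x ^ 4 ≤ v y ^ 2 := by
    calc v x ^ 4 = (v x ^ 2) ^ 2 := by rw [← pow_mul]
      _ ≤ v y ^ 2 := pow_le_pow_left₀ zero_le hle 2
  rw [hsq] at this
  exact (pow_lt_pow_right₀ hx (by norm_num : 3 < 4)).not_ge this

/-- Coefficients of `W.baseChange K`. [folklore] -/
theorem baseChange_a₁ : (W.baseChange K).toAffine.a₁ = algebraMap R K W.a₁ := by
  simp only [WeierstrassCurve.baseChange, WeierstrassCurve.map_a₁]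

/-- Coefficients of `W.baseChange K`. [folklore] -/
theorem baseChange_a₂ : (W.baseChange K).toAffine.a₂ = algebraMap R K W.a₂ := by
  simp only [WeierstrassCurve.baseChange, WeierstrassCurve.map_a₂]

/-- Coefficients of `W.baseChange K`. [folklore] -/
theorem baseChange_a₃ : (W.baseChange K).toAffine.a₃ = algebraMap R K W.a₃ := by
  simp only [WeierstrassCurve.baseChange, WeierstrassCurve.map_a₃]

/-- Coefficients of `W.baseChange K`. [folklore] -/
theorem baseChange_a₄ : (W.baseChange K).toAffine.a₄ = algebraMap R K W.a₄ := by
  simp only [WeierstrassCurve.baseChange, WeierstrassCurve.map_a₄]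

/-- Coefficients of `W.baseChange K`. [folklore] -/
theorem baseChange_a₆ : (W.baseChange K).toAffine.a₆ = algebraMap R K W.a₆ := by
  simp only [WeierstrassCurve.baseChange, WeierstrassCurve.map_a₆]

/-- `negY` commutes with `algebraMap R K`. [folklore] -/
theorem baseChange_negY_algebraMap (a b : R) :
    (W.baseChange K).toAffine.negY (algebraMap R K a) (algebraMap R K b) =
      algebraMap R K (W.toAffine.negY a b) := by
  simp only [WeierstrassCurve.Affine.negY, WeierstrassCurve.baseChange, WeierstrassCurve.map_a₁,
    WeierstrassCurve.map_a₃, map_sub, map_neg, map_mul]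

/-- A point with coordinates in `R` lies on `W.baseChange K` iff it lies on `W`. [folklore] -/
theorem map_equation_iff (hinj : Function.Injective (algebraMap R K)) {a b : R} :
    (W.baseChange K).toAffine.Equation (algebraMap R K a) (algebraMap R K b) ↔
      W.toAffine.Equation a b :=
  WeierstrassCurve.Affine.map_equation _ hinj a b

/-- The chord slope of two points with coordinates in `R` and distinct `x`-coordinates.
[folklore] -/
theorem baseChange_slope_eq_div_of_X_ne (hinj : Function.Injective (algebraMap R K))
    {a₁ b₁ a₂ b₂ : R} (hx : a₁ ≠ a₂) :
    (W.baseChange K).toAffine.slope (algebraMap R K a₁) (algebraMap R K a₂)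
      (algebraMap R K b₁) (algebraMap R K b₂) =
        algebraMap R K (b₁ - b₂) / algebraMap R K (a₁ - a₂) := by
  rw [WeierstrassCurve.Affine.slope_of_X_ne (fun h ↦ hx (hinj h)), map_sub, map_sub]

/-- Trichotomy for `K`-points: `O`, points reducing to `O`, and points with integral
coordinates. [folklore] -/
theorem point_cases (hv : v.Integers R) (P : (W.baseChange K).toAffine.Point) :
    P = 0 ∨ (∃ x y h, P = .some x y h ∧ 1 < v x) ∨
      ∃ (a b : R) (h : (W.baseChange K).toAffine.Nonsingular (algebraMap R K a) (algebraMap R K b)),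
        P = .some _ _ h := by
  rcases P with _ | ⟨x, y, h⟩
  · exact Or.inl rfl
  · by_cases hx : v x ≤ 1
    · obtain ⟨a, rfl⟩ := hv.exists_of_le_one hx
      obtain ⟨b, rfl⟩ := hv.exists_of_le_one (v_Y_le_one_of_v_X_le_one hv h.1 hx)
      exact Or.inr (Or.inr ⟨a, b, h, rfl⟩)
    · exact Or.inr (Or.inl ⟨x, y, h, rfl, not_le.mp hx⟩)

end Coordinates

/-! ### The kernel of reduction is closed under the chord–tangent law -/

section Kernel

variable {K : Type*} [Field K] {Γ₀ : Type*} [LinearOrderedCommGroupWithZero Γ₀]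
  {v : Valuation K Γ₀} {R : Type*} [CommRing R] [Algebra R K]
  {W : WeierstrassCurve R}

/-- Valuations in the `(z, w)`-chart of a point of the kernel of reduction.
[cite: SilvermanAEC2009, VII.2 Prop. 2.2 (PDF p. 170)] -/
theorem v_zw_of_one_lt (hv : v.Integers R) {x y : K}
    (h : (W.baseChange K).toAffine.Equation x y) (hx : 1 < v x) :
    y ≠ 0 ∧ v (-x / y) < 1 ∧ v (-1 / y) < v (-x / y) ^ 2 ∧ v (-1 / y) = v (-x / y) ^ 3 ∧
      v (-x / y) ^ 2 * v x = 1 := by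
  obtain ⟨hxy, hsq⟩ := v_X_lt_v_Y_of_one_lt hv h hx
  have hylt := v_Y_lt_v_X_sq_of_one_lt hv h hx
  have hx0 : (0 : Γ₀) < v x := lt_trans zero_lt_one hx
  have hy0 : (0 : Γ₀) < v y := hx0.trans hxy
  have hy : y ≠ 0 := by
    intro hy; rw [hy, map_zero] at hy0; exact lt_irrefl _ hy0
  have hvy : v y ≠ 0 := hy0.ne'
  have hz : v (-x / y) = v x / v y := by rw [map_div₀, Valuation.map_neg]
  have hw : v (-1 / y) = (v y)⁻¹ := by rw [map_div₀, Valuation.map_neg, map_one, one_div]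
  refine ⟨hy, ?_, ?_, ?_, ?_⟩
  · rw [hz, div_lt_one₀ hy0]; exact hxy
  · rw [hz, hw, div_pow, lt_div_iff₀ (pow_pos hy0 2), inv_mul_eq_div, sq, mul_div_assoc,
      div_self hvy, mul_one]
    exact hylt
  · rw [hz, hw, div_pow, ← hsq, eq_div_iff (pow_ne_zero 3 hvy), pow_succ', ← mul_assoc,
      inv_mul_cancel₀ hvy, one_mul]
  · rw [hz, div_pow, div_mul_eq_mul_div, ← pow_succ, hsq.symm, div_self (pow_ne_zero 2 hvy)]

/-- **Kernel of reduction, chord case.**  If `P = (x₁, y₁)` and `Q = (x₂, y₂)` both reduce to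
`O` (`1 < v x₁`, `1 < v x₂`) and `x₁ ≠ x₂`, then so does `P + Q`.
[cite: SilvermanAEC2009, VII.2 Prop. 2.1 with IV.1 (PDF pp. 167, 111)] -/
theorem one_lt_v_addX_of_one_lt_of_X_ne (hv : v.Integers R) {x₁ x₂ y₁ y₂ : K}
    (h₁ : (W.baseChange K).toAffine.Equation x₁ y₁) (h₂ : (W.baseChange K).toAffine.Equation x₂ y₂)
    (hx₁ : 1 < v x₁) (hx₂ : 1 < v x₂) (hx : x₁ ≠ x₂) :
    1 < v ((W.baseChange K).toAffine.addX x₁ x₂ ((W.baseChange K).toAffine.slope x₁ x₂ y₁ y₂)) := by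
  obtain ⟨hy₁, hz₁, hwz₁, hw₁, hF₁⟩ := v_zw_of_one_lt hv h₁ hx₁
  obtain ⟨hy₂, hz₂, hwz₂, hw₂, hF₂⟩ := v_zw_of_one_lt hv h₂ hx₂
  set W' := (W.baseChange K).toAffine with hW'
  have h1 := hv.map_le_one
  have ha₁ : v W'.a₁ ≤ 1 := by
    simp only [hW', WeierstrassCurve.baseChange, WeierstrassCurve.map_a₁]; exact h1 _
  have ha₂ : v W'.a₂ ≤ 1 := by
    simp only [hW', WeierstrassCurve.baseChange, WeierstrassCurve.map_a₂]; exact h1 _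
  have ha₃ : v W'.a₃ ≤ 1 := by
    simp only [hW', WeierstrassCurve.baseChange, WeierstrassCurve.map_a₃]; exact h1 _
  have ha₄ : v W'.a₄ ≤ 1 := by
    simp only [hW', WeierstrassCurve.baseChange, WeierstrassCurve.map_a₄]; exact h1 _
  have ha₆ : v W'.a₆ ≤ 1 := by
    simp only [hW', WeierstrassCurve.baseChange, WeierstrassCurve.map_a₆]; exact h1 _
  -- the `(z, w)`-chart
  set z₁ := -x₁ / y₁ with hz₁def
  set w₁ := -1 / y₁ with hw₁def
  set z₂ := -x₂ / y₂ with hz₂def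
  set w₂ := -1 / y₂ with hw₂def
  have hzw₁ := WeierstrassCurve.Affine.equation_zw W' h₁ hy₁
  have hzw₂ := WeierstrassCurve.Affine.equation_zw W' h₂ hy₂
  rw [← hz₁def, ← hw₁def] at hzw₁
  rw [← hz₂def, ← hw₂def] at hzw₂
  set A := z₁ ^ 2 + z₁ * z₂ + z₂ ^ 2 + W'.a₁ * w₁ + W'.a₂ * (z₁ + z₂) * w₁ + W'.a₄ * w₁ ^ 2
    with hAdef
  set B := 1 - W'.a₁ * z₂ - W'.a₂ * z₂ ^ 2 - W'.a₃ * (w₁ + w₂) - W'.a₄ * z₂ * (w₁ + w₂)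
    - W'.a₆ * (w₁ ^ 2 + w₁ * w₂ + w₂ ^ 2) with hBdef
  have hAB : (w₁ - w₂) * B = (z₁ - z₂) * A := WeierstrassCurve.Affine.zw_chord hzw₁ hzw₂
  set lam := W'.slope x₁ x₂ y₁ y₂ with hlamdef
  have hlam : lam = (y₁ - y₂) / (x₁ - x₂) := WeierstrassCurve.Affine.slope_of_X_ne hx
  set c := y₁ - lam * x₁ with hcdef
  set N := B * w₁ - A * z₁ with hNdef
  have hN₂ : N = B * w₂ - A * z₂ := by rw [hNdef]; linear_combination hAB
  have hcN : c * N = -B := by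
    rw [hcdef, hNdef, hlam, hz₁def, hw₁def]
    refine WeierstrassCurve.Affine.chord_intercept_mul hy₁ hy₂ hx ?_
    rw [← hz₁def, ← hw₁def, ← hz₂def, ← hw₂def]
    exact hAB
  have hI3 : x₁ * x₂ * W'.addX x₁ x₂ lam = c ^ 2 + W'.a₃ * c - W'.a₆ :=
    WeierstrassCurve.Affine.X_mul_X_mul_addX_slope W' h₁ h₂ (fun h ↦ hx h.1)
  -- elementary inequalities in `Γ₀`
  have hml : ∀ {a b : Γ₀}, a ≤ 1 → b < 1 → a * b < 1 :=
    fun ha hb ↦ (mul_le_of_le_one_left' ha).trans_lt hb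
  have hml' : ∀ {a b c : Γ₀}, a ≤ 1 → b ≤ c → a * b ≤ c :=
    fun ha hb ↦ (mul_le_of_le_one_left' ha).trans hb
  set S := max (v z₁) (v z₂) with hSdef
  have hS1 : S < 1 := max_lt hz₁ hz₂
  have hzS₁ : v z₁ ≤ S := le_max_left _ _
  have hzS₂ : v z₂ ≤ S := le_max_right _ _
  have hvw₁ : v w₁ < 1 := hwz₁.trans_le ((pow_le_one₀ zero_le hz₁.le))
  have hvw₂ : v w₂ < 1 := hwz₂.trans_le ((pow_le_one₀ zero_le hz₂.le))
  have hvw₁S : v w₁ ≤ S ^ 2 := hwz₁.le.trans (pow_le_pow_left₀ zero_le hzS₁ 2)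
  have hvw₂S : v w₂ ≤ S ^ 2 := hwz₂.le.trans (pow_le_pow_left₀ zero_le hzS₂ 2)
  -- `v B = 1`
  have hvB : v B = 1 := by
    have : B = 1 - (W'.a₁ * z₂ + W'.a₂ * z₂ ^ 2 + W'.a₃ * (w₁ + w₂) + W'.a₄ * z₂ * (w₁ + w₂)
        + W'.a₆ * (w₁ ^ 2 + w₁ * w₂ + w₂ ^ 2)) := by rw [hBdef]; ring
    rw [this]
    apply Valuation.map_one_sub_of_lt
    have hww : v (w₁ + w₂) < 1 := v.map_add_lt hvw₁ hvw₂
    refine v.map_add_lt (v.map_add_lt (v.map_add_lt (v.map_add_lt ?_ ?_) ?_) ?_) ?_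
    · rw [map_mul]; exact hml ha₁ hz₂
    · rw [map_mul, map_pow]; exact hml ha₂ (pow_lt_one₀ zero_le hz₂ two_ne_zero)
    · rw [map_mul]; exact hml ha₃ hww
    · rw [map_mul, map_mul]; exact hml (mul_le_one' ha₄ hz₂.le) hww
    · rw [map_mul]
      refine hml ha₆ (v.map_add_lt (v.map_add_lt ?_ ?_) ?_)
      · rw [map_pow]; exact pow_lt_one₀ zero_le hvw₁ two_ne_zero
      · rw [map_mul]; exact hml hvw₁.le hvw₂
      · rw [map_pow]; exact pow_lt_one₀ zero_le hvw₂ two_ne_zero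
  -- `v A ≤ S ^ 2`
  have hvA : v A ≤ S ^ 2 := by
    refine v.map_add_le (v.map_add_le (v.map_add_le (v.map_add_le (v.map_add_le ?_ ?_) ?_) ?_)
      ?_) ?_
    · rw [map_pow]; exact pow_le_pow_left₀ zero_le hzS₁ 2
    · rw [map_mul, sq]; exact mul_le_mul' hzS₁ hzS₂
    · rw [map_pow]; exact pow_le_pow_left₀ zero_le hzS₂ 2
    · rw [map_mul]; exact hml' ha₁ hvw₁S
    · rw [map_mul, map_mul]
      exact hml' (mul_le_one' ha₂ ((v.map_add_le hzS₁ hzS₂).trans hS1.le)) hvw₁S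
    · rw [map_mul, map_pow]
      exact hml' ha₄ ((pow_le_of_le_one zero_le hvw₁.le two_ne_zero).trans hvw₁S)
  -- `v N ≤ S · v z₁ · v z₂`
  have hvN : v N ≤ S * (v z₁ * v z₂) := by
    rcases le_total (v z₁) (v z₂) with hle | hle
    · have hS : S = v z₂ := max_eq_right hle
      have hvA' : v A ≤ v z₂ ^ 2 := by rw [← hS]; exact hvA
      rw [hS, hNdef]
      refine v.map_sub_le ?_ ?_
      · rw [map_mul, hvB, one_mul, hw₁]
        calc v z₁ ^ 3 = v z₁ * (v z₁ * v z₁) := by rw [pow_succ, sq]; ac_rfl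
          _ ≤ v z₂ * (v z₁ * v z₂) := mul_le_mul' hle (mul_le_mul' le_rfl hle)
      · rw [map_mul]
        calc v A * v z₁ ≤ v z₂ ^ 2 * v z₁ := mul_le_mul' hvA' le_rfl
          _ = v z₂ * (v z₁ * v z₂) := by rw [sq]; ac_rfl
    · have hS : S = v z₁ := max_eq_left hle
      have hvA' : v A ≤ v z₁ ^ 2 := by rw [← hS]; exact hvA
      rw [hS, hN₂]
      refine v.map_sub_le ?_ ?_
      · rw [map_mul, hvB, one_mul, hw₂]
        calc v z₂ ^ 3 = v z₂ * (v z₂ * v z₂) := by rw [pow_succ, sq]; ac_rfl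
          _ ≤ v z₁ * (v z₁ * v z₂) := mul_le_mul' hle (mul_le_mul' hle le_rfl)
      · rw [map_mul]
        calc v A * v z₂ ≤ v z₁ ^ 2 * v z₂ := mul_le_mul' hvA' le_rfl
          _ = v z₁ * (v z₁ * v z₂) := by rw [sq]; ac_rfl
  -- `v c * v N = 1`
  have hcN' : v c * v N = 1 := by rw [← map_mul, hcN, Valuation.map_neg, hvB]
  -- `v x₁ * v x₂ < v c ^ 2`
  have hX : v x₁ * v x₂ < v c ^ 2 := by
    have key : v N ^ 2 * (v x₁ * v x₂) < 1 := by
      calc v N ^ 2 * (v x₁ * v x₂) ≤ (S * (v z₁ * v z₂)) ^ 2 * (v x₁ * v x₂) :=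
            mul_le_mul' (pow_le_pow_left₀ zero_le hvN 2) le_rfl
        _ = S ^ 2 * ((v z₁ ^ 2 * v x₁) * (v z₂ ^ 2 * v x₂)) := by rw [mul_pow, mul_pow]; ac_rfl
        _ = S ^ 2 := by rw [hF₁, hF₂, mul_one, mul_one]
        _ < 1 := pow_lt_one₀ zero_le hS1 two_ne_zero
    have : v x₁ * v x₂ * v N ^ 2 < v c ^ 2 * v N ^ 2 := by
      rw [← mul_pow (v c), hcN', one_pow, mul_comm]; exact key
    exact lt_of_mul_lt_mul_right' this
  have hX1 : 1 < v x₁ * v x₂ := one_lt_mul'' hx₁ hx₂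
  have hc1 : 1 < v c := by
    by_contra hle
    rw [not_lt] at hle
    exact ((hX1.trans hX).trans_le (pow_le_one₀ zero_le hle)).false
  -- `v (c² + a₃ c - a₆) = v c ^ 2`
  have hlt : v (W'.a₃ * c - W'.a₆) < v (c ^ 2) := by
    rw [map_pow]
    refine v.map_sub_lt ?_ ?_
    · rw [map_mul]
      calc v W'.a₃ * v c ≤ 1 * v c := mul_le_mul' ha₃ le_rfl
        _ = v c ^ 1 := by rw [one_mul, pow_one]
        _ < v c ^ 2 := pow_lt_pow_right₀ hc1 one_lt_two
    · exact ha₆.trans_lt (one_lt_pow₀ hc1 two_ne_zero)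
  have hCc : v (c ^ 2 + W'.a₃ * c - W'.a₆) = v c ^ 2 := by
    rw [add_sub_assoc, v.map_add_eq_of_lt_left hlt, map_pow]
  -- conclude
  have hfin : v x₁ * v x₂ * v (W'.addX x₁ x₂ lam) = v c ^ 2 := by
    rw [← map_mul, ← map_mul, hI3, hCc]
  have : v x₁ * v x₂ * 1 < v x₁ * v x₂ * v (W'.addX x₁ x₂ lam) := by rw [mul_one, hfin]; exact hX
  exact lt_of_mul_lt_mul_left' this

/-- **Kernel of reduction, tangent case.**  If `P = (x, y)` reduces to `O` (`1 < v x`) and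
`P ≠ -P`, then `P + P` reduces to `O`. [cite: SilvermanAEC2009, VII.2 Prop. 2.1 (PDF p. 167)] -/
theorem one_lt_v_addX_self_of_one_lt (hv : v.Integers R) {x y : K}
    (h : (W.baseChange K).toAffine.Equation x y) (hx : 1 < v x)
    (hy : y ≠ (W.baseChange K).toAffine.negY x y) :
    1 < v ((W.baseChange K).toAffine.addX x x ((W.baseChange K).toAffine.slope x x y y)) := by
  obtain ⟨hxy, hsq⟩ := v_X_lt_v_Y_of_one_lt hv h hx
  set W' := (W.baseChange K).toAffine with hW'
  have h1 := hv.map_le_one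
  have ha₁ : v W'.a₁ ≤ 1 := by
    simp only [hW', WeierstrassCurve.baseChange, WeierstrassCurve.map_a₁]; exact h1 _
  have ha₂ : v W'.a₂ ≤ 1 := by
    simp only [hW', WeierstrassCurve.baseChange, WeierstrassCurve.map_a₂]; exact h1 _
  have ha₃ : v W'.a₃ ≤ 1 := by
    simp only [hW', WeierstrassCurve.baseChange, WeierstrassCurve.map_a₃]; exact h1 _
  have ha₄ : v W'.a₄ ≤ 1 := by
    simp only [hW', WeierstrassCurve.baseChange, WeierstrassCurve.map_a₄]; exact h1 _
  have ha₆ : v W'.a₆ ≤ 1 := by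
    simp only [hW', WeierstrassCurve.baseChange, WeierstrassCurve.map_a₆]; exact h1 _
  have h2 : v (2 : K) ≤ 1 := by rw [← map_ofNat (algebraMap R K) 2]; exact h1 _
  have h3 : v (3 : K) ≤ 1 := by rw [← map_ofNat (algebraMap R K) 3]; exact h1 _
  have hx0 : (0 : Γ₀) < v x := lt_trans zero_lt_one hx
  have hy1 : (1 : Γ₀) < v y := hx.trans hxy
  have hy0 : (0 : Γ₀) < v y := lt_trans zero_lt_one hy1
  set lam := W'.slope x x y y with hlamdef
  set c := y - lam * x with hcdef
  have hI3 : x * x * W'.addX x x lam = c ^ 2 + W'.a₃ * c - W'.a₆ :=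
    WeierstrassCurve.Affine.X_mul_X_mul_addX_slope W' h h (fun h' ↦ hy h'.2)
  have hcD : c * (y - W'.negY x y) =
      -(y ^ 2 + W'.a₁ * x * y + 2 * W'.a₃ * y - W'.a₂ * x ^ 2 - 2 * W'.a₄ * x - 3 * W'.a₆) :=
    WeierstrassCurve.Affine.Y_sub_slope_mul_X_mul W' h hy
  -- `v` of the right-hand side is `v y ^ 2`
  have hY2 : v y ^ 1 < v y ^ 2 := pow_lt_pow_right₀ hy1 one_lt_two
  rw [pow_one] at hY2
  have hM : v (y ^ 2 + W'.a₁ * x * y + 2 * W'.a₃ * y - W'.a₂ * x ^ 2 - 2 * W'.a₄ * x - 3 * W'.a₆)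
      = v y ^ 2 := by
    have : y ^ 2 + W'.a₁ * x * y + 2 * W'.a₃ * y - W'.a₂ * x ^ 2 - 2 * W'.a₄ * x - 3 * W'.a₆ =
        y ^ 2 + (W'.a₁ * x * y + 2 * W'.a₃ * y - W'.a₂ * x ^ 2 - 2 * W'.a₄ * x - 3 * W'.a₆) := by
      ring
    rw [this, ← map_pow]
    refine v.map_add_eq_of_lt_left ?_
    rw [map_pow]
    have hle1 : ∀ {a b : Γ₀}, a ≤ 1 → a * b ≤ b := fun ha ↦ mul_le_of_le_one_left' ha
    refine v.map_sub_lt (v.map_sub_lt (v.map_sub_lt (v.map_add_lt ?_ ?_) ?_) ?_) ?_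
    · rw [map_mul, map_mul, sq]
      calc v W'.a₁ * v x * v y ≤ v x * v y := mul_le_mul' (hle1 ha₁) le_rfl
        _ < v y * v y := mul_lt_mul_of_pos_right hxy hy0
    · rw [map_mul, map_mul]
      exact (hle1 (mul_le_one' h2 ha₃)).trans_lt hY2
    · rw [map_mul, map_pow]
      exact (hle1 ha₂).trans_lt (pow_lt_pow_left₀ hxy zero_le two_ne_zero)
    · rw [map_mul, map_mul]
      exact (hle1 (mul_le_one' h2 ha₄)).trans_lt (hxy.trans hY2)
    · rw [map_mul]
      exact (mul_le_one' h3 ha₆).trans_lt (one_lt_pow₀ hy1 two_ne_zero)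
  -- `v (y - negY) ≤ v y`
  have hD : v (y - W'.negY x y) ≤ v y := by
    have : y - W'.negY x y = 2 * y + W'.a₁ * x + W'.a₃ := by
      rw [WeierstrassCurve.Affine.negY]; ring
    rw [this]
    refine v.map_add_le (v.map_add_le ?_ ?_) (ha₃.trans hy1.le)
    · rw [map_mul]; exact mul_le_of_le_one_left' h2
    · rw [map_mul]; exact (mul_le_of_le_one_left' ha₁).trans hxy.le
  have hcD' : v c * v (y - W'.negY x y) = v y ^ 2 := by
    rw [← map_mul, hcD, Valuation.map_neg, hM]
  have hcY : v y ≤ v c := by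
    by_contra hlt
    rw [not_le] at hlt
    have : v c * v (y - W'.negY x y) < v y * v y :=
      calc v c * v (y - W'.negY x y) ≤ v c * v y := mul_le_mul' le_rfl hD
        _ < v y * v y := mul_lt_mul_of_pos_right hlt hy0
    rw [hcD', sq] at this
    exact lt_irrefl _ this
  have hc1 : 1 < v c := hy1.trans_le hcY
  -- `v (c² + a₃ c - a₆) = v c ^ 2`
  have hlt : v (W'.a₃ * c - W'.a₆) < v (c ^ 2) := by
    rw [map_pow]
    refine v.map_sub_lt ?_ ?_
    · rw [map_mul]
      calc v W'.a₃ * v c ≤ 1 * v c := mul_le_mul' ha₃ le_rfl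
        _ = v c ^ 1 := by rw [one_mul, pow_one]
        _ < v c ^ 2 := pow_lt_pow_right₀ hc1 one_lt_two
    · exact ha₆.trans_lt (one_lt_pow₀ hc1 two_ne_zero)
  have hCc : v (c ^ 2 + W'.a₃ * c - W'.a₆) = v c ^ 2 := by
    rw [add_sub_assoc, v.map_add_eq_of_lt_left hlt, map_pow]
  -- conclude
  have hfin : v x * v x * v (W'.addX x x lam) = v c ^ 2 := by
    rw [← map_mul, ← map_mul, hI3, hCc]
  have : v x * v x * 1 < v x * v x * v (W'.addX x x lam) := by
    rw [mul_one, hfin]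
    calc v x * v x = v x ^ 2 := (sq _).symm
      _ < v y ^ 2 := pow_lt_pow_left₀ hxy zero_le two_ne_zero
      _ ≤ v c ^ 2 := pow_le_pow_left₀ zero_le hcY 2
  exact lt_of_mul_lt_mul_left' this

/-- **The kernel of reduction is closed under the chord-tangent law** (Silverman, *AEC* VII.2.1,
case `P̃ = Q̃ = Õ`): if `P = (x₁, y₁)` and `Q = (x₂, y₂)` both reduce to `O` and `Q ≠ -P`, then
`P + Q` reduces to `O`. [cite: SilvermanAEC2009, VII.2 Prop. 2.1 (PDF p. 167)] -/
theorem one_lt_v_addX_of_one_lt (hv : v.Integers R) {x₁ x₂ y₁ y₂ : K}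
    (h₁ : (W.baseChange K).toAffine.Equation x₁ y₁) (h₂ : (W.baseChange K).toAffine.Equation x₂ y₂)
    (hx₁ : 1 < v x₁) (hx₂ : 1 < v x₂)
    (hxy : ¬(x₁ = x₂ ∧ y₁ = (W.baseChange K).toAffine.negY x₂ y₂)) :
    1 < v ((W.baseChange K).toAffine.addX x₁ x₂ ((W.baseChange K).toAffine.slope x₁ x₂ y₁ y₂)) := by
  by_cases hx : x₁ = x₂
  · have hy : y₁ ≠ (W.baseChange K).toAffine.negY x₂ y₂ := fun h ↦ hxy ⟨hx, h⟩
    subst hx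
    have hyy : y₁ = y₂ := WeierstrassCurve.Affine.Y_eq_of_Y_ne h₁ h₂ rfl hy
    subst hyy
    exact one_lt_v_addX_self_of_one_lt hv h₁ hx₁ hy
  · exact one_lt_v_addX_of_one_lt_of_X_ne hv h₁ h₂ hx₁ hx₂ hx

end Kernel

/-! ### A point of the kernel plus a point with integral coordinates: the `x`-coordinate -/

section Mixed

variable {K : Type*} [Field K] {Γ₀ : Type*} [LinearOrderedCommGroupWithZero Γ₀]
  {v : Valuation K Γ₀} {R : Type*} [CommRing R] [Algebra R K]
  {W : WeierstrassCurve R}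

/-- **Kernel plus finite point** (Silverman, *AEC* VII.2.1, case `P̃ = Õ ≠ Q̃`, `x`-coordinate):
if `P = (x₁, y₁)` reduces to `O` and `Q = (x₂, y₂)` has integral coordinates, then
`x(P + Q) ≡ x(Q)` modulo the maximal ideal.
[cite: SilvermanAEC2009, VII.2 Prop. 2.1 (PDF p. 168)] -/
theorem v_addX_sub_X_lt_one (hv : v.Integers R) {x₁ x₂ y₁ y₂ : K}
    (h₁ : (W.baseChange K).toAffine.Equation x₁ y₁) (h₂ : (W.baseChange K).toAffine.Equation x₂ y₂)
    (hx₁ : 1 < v x₁) (hx₂ : v x₂ ≤ 1) :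
    v ((W.baseChange K).toAffine.addX x₁ x₂ ((W.baseChange K).toAffine.slope x₁ x₂ y₁ y₂) - x₂)
      < 1 := by
  obtain ⟨hxy, hsq⟩ := v_X_lt_v_Y_of_one_lt hv h₁ hx₁
  have hylt := v_Y_lt_v_X_sq_of_one_lt hv h₁ hx₁
  have hy₂ : v y₂ ≤ 1 := v_Y_le_one_of_v_X_le_one hv h₂ hx₂
  set W' := (W.baseChange K).toAffine with hW'
  have h1 := hv.map_le_one
  have ha₁ : v W'.a₁ ≤ 1 := by
    simp only [hW', WeierstrassCurve.baseChange, WeierstrassCurve.map_a₁]; exact h1 _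
  have ha₂ : v W'.a₂ ≤ 1 := by
    simp only [hW', WeierstrassCurve.baseChange, WeierstrassCurve.map_a₂]; exact h1 _
  have ha₃ : v W'.a₃ ≤ 1 := by
    simp only [hW', WeierstrassCurve.baseChange, WeierstrassCurve.map_a₃]; exact h1 _
  have ha₄ : v W'.a₄ ≤ 1 := by
    simp only [hW', WeierstrassCurve.baseChange, WeierstrassCurve.map_a₄]; exact h1 _
  have ha₆ : v W'.a₆ ≤ 1 := by
    simp only [hW', WeierstrassCurve.baseChange, WeierstrassCurve.map_a₆]; exact h1 _
  have h2 : v (2 : K) ≤ 1 := by rw [← map_ofNat (algebraMap R K) 2]; exact h1 _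
  have h3 : v (3 : K) ≤ 1 := by rw [← map_ofNat (algebraMap R K) 3]; exact h1 _
  have hx : x₁ ≠ x₂ := by rintro rfl; exact hx₂.not_gt hx₁
  have hX1 : (1 : Γ₀) ≤ v x₁ := hx₁.le
  have hY1 : v x₁ ≤ v y₁ := hxy.le
  have hle1 : ∀ {a b : Γ₀}, a ≤ 1 → a * b ≤ b := fun ha ↦ mul_le_of_le_one_left' ha
  -- the identity `(x₃ - x₂)(x₁ - x₂)² = M₂`
  have hid : (W'.addX x₁ x₂ (W'.slope x₁ x₂ y₁ y₂) - x₂) * (x₁ - x₂) ^ 2 =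
      3 * x₁ * x₂ ^ 2 - x₂ ^ 3 + 2 * W'.a₂ * x₁ * x₂ + W'.a₄ * (x₁ + x₂) + 2 * W'.a₆
        - W'.a₁ * (x₁ * y₂ + x₂ * y₁) - W'.a₃ * (y₁ + y₂) - 2 * y₁ * y₂ := by
    have := WeierstrassCurve.Affine.addX_slope_mul_sub_sq W' h₁ h₂ hx
    linear_combination this
  -- `v M₂ ≤ v y₁`
  have hM : v (3 * x₁ * x₂ ^ 2 - x₂ ^ 3 + 2 * W'.a₂ * x₁ * x₂ + W'.a₄ * (x₁ + x₂) + 2 * W'.a₆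
        - W'.a₁ * (x₁ * y₂ + x₂ * y₁) - W'.a₃ * (y₁ + y₂) - 2 * y₁ * y₂) ≤ v y₁ := by
    refine v.map_sub_le (v.map_sub_le (v.map_sub_le (v.map_add_le (v.map_add_le (v.map_add_le
      (v.map_sub_le ?_ ?_) ?_) ?_) ?_) ?_) ?_) ?_
    · rw [map_mul, map_mul, map_pow]
      calc v 3 * v x₁ * v x₂ ^ 2 ≤ v x₁ * 1 := mul_le_mul' (hle1 h3) (pow_le_one₀ zero_le hx₂)
        _ = v x₁ := mul_one _
        _ ≤ v y₁ := hY1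
    · rw [map_pow]; exact (pow_le_one₀ zero_le hx₂).trans (hX1.trans hY1)
    · rw [map_mul, map_mul, map_mul]
      calc v 2 * v W'.a₂ * v x₁ * v x₂ ≤ v x₁ * 1 := mul_le_mul' (hle1 (mul_le_one' h2 ha₂)) hx₂
        _ = v x₁ := mul_one _
        _ ≤ v y₁ := hY1
    · rw [map_mul]
      exact (hle1 ha₄).trans ((v.map_add_le le_rfl (hx₂.trans hX1)).trans hY1)
    · rw [map_mul]; exact (mul_le_one' h2 ha₆).trans (hX1.trans hY1)
    · rw [map_mul]
      refine (hle1 ha₁).trans (v.map_add_le ?_ ?_)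
      · rw [map_mul]; exact (mul_le_mul' le_rfl hy₂).trans ((mul_one _).le.trans hY1)
      · rw [map_mul]; exact hle1 hx₂
    · rw [map_mul]
      exact (hle1 ha₃).trans (v.map_add_le le_rfl (hy₂.trans (hX1.trans hY1)))
    · rw [map_mul, map_mul]
      calc v 2 * v y₁ * v y₂ ≤ v y₁ * 1 := mul_le_mul' (hle1 h2) hy₂
        _ = v y₁ := mul_one _
  -- `v (x₁ - x₂) = v x₁`
  have hsub : v (x₁ - x₂) = v x₁ := v.map_sub_eq_of_lt_left (hx₂.trans_lt hx₁)
  have key : v (W'.addX x₁ x₂ (W'.slope x₁ x₂ y₁ y₂) - x₂) * v x₁ ^ 2 < 1 * v x₁ ^ 2 := by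
    rw [← hsub, ← map_pow, ← map_mul, hid, one_mul, map_pow, hsub]
    exact hM.trans_lt hylt
  exact lt_of_mul_lt_mul_right' key

/-- If the slope of the line through two integral points has valuation `> 1`, then the third
intersection point reduces to `O`. [folklore] -/
theorem one_lt_v_addX_of_one_lt_v_slope (hv : v.Integers R) {x₁ x₂ L : K}
    (hx₁ : v x₁ ≤ 1) (hx₂ : v x₂ ≤ 1) (hL : 1 < v L) :
    1 < v ((W.baseChange K).toAffine.addX x₁ x₂ L) := by
  set W' := (W.baseChange K).toAffine with hW'
  have h1 := hv.map_le_one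
  have ha₁ : v W'.a₁ ≤ 1 := by
    simp only [hW', WeierstrassCurve.baseChange, WeierstrassCurve.map_a₁]; exact h1 _
  have ha₂ : v W'.a₂ ≤ 1 := by
    simp only [hW', WeierstrassCurve.baseChange, WeierstrassCurve.map_a₂]; exact h1 _
  have hL2 : v L < v L ^ 2 := by
    conv_lhs => rw [← pow_one (v L)]
    exact pow_lt_pow_right₀ hL one_lt_two
  have h1L2 : (1 : Γ₀) < v L ^ 2 := one_lt_pow₀ hL two_ne_zero
  have : W'.addX x₁ x₂ L = L ^ 2 + (W'.a₁ * L - W'.a₂ - x₁ - x₂) := by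
    rw [WeierstrassCurve.Affine.addX]; ring
  rw [this, v.map_add_eq_of_lt_left, map_pow]
  · exact h1L2
  · rw [map_pow]
    refine v.map_sub_lt (v.map_sub_lt (v.map_sub_lt ?_ (ha₂.trans_lt h1L2)) (hx₁.trans_lt h1L2))
      (hx₂.trans_lt h1L2)
    rw [map_mul]
    exact (mul_le_of_le_one_left' ha₁).trans_lt hL2

end Mixed

end Literature.NumberTheory.EllipticCurves

/-! ## The reduction map, `E₀(K)` and `E₁(K)` -/

namespace WeierstrassCurve

open Literature.NumberTheory.EllipticCurves

section Definitions

variable {R : Type*} [CommRing R] [IsLocalRing R] {K : Type*} [Field K] [Algebra R K]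
  (W : WeierstrassCurve R)

/-- `P ∈ E₁(K)`: the `K`-point `P` of the Weierstrass equation `W` (with coefficients in the local
ring `R`) *reduces to the point at infinity*, i.e. `P = O` or `P = (x, y)` with `x ∉ R`
(Silverman, *AEC* VII.2, "the kernel of reduction").
[cite: SilvermanAEC2009, VII.2 (definition of E₁(K), PDF p. 167)] -/
def ReducesToZero : (W.baseChange K).toAffine.Point → Prop
  | 0 => True
  | .some x _ _ => x ∉ Set.range (algebraMap R K)
/-- `P ∈ E₀(K)`: the `K`-point `P` of `W` has *nonsingular reduction*: `P = O`, or `P = (x, y)`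
with `x ∉ R` (then `P̃ = Õ`), or `x, y ∈ R` and `(x̄, ȳ)` is a nonsingular point of the reduced
curve `W̃ = W mod 𝔪` (Silverman, *AEC* VII.2, "the set of points with nonsingular reduction").
Same shape as `WeierstrassCurve.IsNonsingularReductionPoint` of `Tamagawa.lean` (there for a
discrete valuation ring and Mathlib's `W.reduction`).
[cite: SilvermanAEC2009, VII.2 (definition of E₀(K), PDF p. 167)] -/
def HasNonsingularReduction : (W.baseChange K).toAffine.Point → Prop
  | 0 => True
  | .some x y _ => x ∉ Set.range (algebraMap R K) ∨
      ∃ x₀ y₀ : R, algebraMap R K x₀ = x ∧ algebraMap R K y₀ = y ∧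
        (W.map (IsLocalRing.residue R)).toAffine.Nonsingular (IsLocalRing.residue R x₀)
          (IsLocalRing.residue R y₀)
/-- The reduction map `P ↦ P̃` from `K`-points of `W` to points of the reduced curve
`W̃ = W.map (IsLocalRing.residue R)` over the residue field (Silverman, *AEC* VII.2), with values
in Mathlib's group `W̃.toAffine.Point` of *nonsingular* points: `O ↦ Õ`, a point `(x, y)` with
`x ∉ R` goes to `Õ`, a point with `x, y ∈ R` and `(x̄, ȳ)` nonsingular goes to `(x̄, ȳ)`, and a
point with singular reduction is sent to the junk value `Õ` (the map is meant to be used on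
`E₀(K)`, see `HasNonsingularReduction`).
[cite: SilvermanAEC2009, VII.2 (the reduction map, PDF pp. 166–167)] -/
def reducePoint : (W.baseChange K).toAffine.Point → (W.map (IsLocalRing.residue R)).toAffine.Point
  | 0 => 0
  | .some x y _ =>
      if h : ∃ x₀ y₀ : R, algebraMap R K x₀ = x ∧ algebraMap R K y₀ = y ∧
          (W.map (IsLocalRing.residue R)).toAffine.Nonsingular (IsLocalRing.residue R x₀)
            (IsLocalRing.residue R y₀)
      then .some _ _ h.choose_spec.choose_spec.2.2 else 0

variable {W}

omit [IsLocalRing R] in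
/-- `O ∈ E₁(K)`. [folklore] -/
@[simp] theorem reducesToZero_zero :
    ReducesToZero W (0 : (W.baseChange K).toAffine.Point) := trivial

/-- `O ∈ E₀(K)`. [folklore] -/
@[simp] theorem hasNonsingularReduction_zero :
    HasNonsingularReduction W (0 : (W.baseChange K).toAffine.Point) := trivial

/-- `Õ` is the reduction of `O`. [folklore] -/
@[simp] theorem reducePoint_zero :
    reducePoint W (0 : (W.baseChange K).toAffine.Point) = 0 := rfl

omit [IsLocalRing R] in
/-- An affine point reduces to `O` iff its `x`-coordinate is not in `R`. [folklore] -/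
theorem reducesToZero_some_iff {x y : K} (h : (W.baseChange K).toAffine.Nonsingular x y) :
    ReducesToZero W (.some x y h) ↔ x ∉ Set.range (algebraMap R K) := Iff.rfl

/-- `E₁(K) ⊆ E₀(K)`. [folklore] -/
theorem ReducesToZero.hasNonsingularReduction {P : (W.baseChange K).toAffine.Point}
    (hP : ReducesToZero W P) : HasNonsingularReduction W P := by
  rcases P with _ | ⟨x, y, h⟩
  · trivial
  · exact Or.inl hP

/-- A point with `x ∉ R` reduces to `Õ`. [folklore] -/
theorem reducePoint_some_of_not_mem {x y : K} (h : (W.baseChange K).toAffine.Nonsingular x y)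
    (hx : x ∉ Set.range (algebraMap R K)) : reducePoint W (.some x y h) = 0 := by
  rw [reducePoint, dif_neg]
  rintro ⟨x₀, y₀, hx₀, -, -⟩
  exact hx ⟨x₀, hx₀⟩

/-- Points of `E₁(K)` reduce to `Õ`. [folklore] -/
theorem ReducesToZero.reducePoint_eq_zero {P : (W.baseChange K).toAffine.Point}
    (hP : ReducesToZero W P) : reducePoint W P = 0 := by
  rcases P with _ | ⟨x, y, h⟩
  · rfl
  · exact reducePoint_some_of_not_mem h hP

/-- A point `(a, b)` with coordinates in `R` is in `E₀(K)` iff `(ā, b̄)` is nonsingular on `W̃`.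
[folklore] -/
theorem hasNonsingularReduction_some_algebraMap_iff (hinj : Function.Injective (algebraMap R K))
    {a b : R} (h : (W.baseChange K).toAffine.Nonsingular (algebraMap R K a) (algebraMap R K b)) :
    HasNonsingularReduction W (.some _ _ h) ↔
      (W.map (IsLocalRing.residue R)).toAffine.Nonsingular (IsLocalRing.residue R a)
        (IsLocalRing.residue R b) := by
  simp only [HasNonsingularReduction, Set.mem_range, not_exists]
  constructor
  · rintro (hx | ⟨x₀, y₀, hx₀, hy₀, hns⟩)
    · exact (hx a rfl).elim
    · rwa [← hinj hx₀, ← hinj hy₀]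
  · exact fun hns ↦ Or.inr ⟨a, b, rfl, rfl, hns⟩

/-- The reduction of a point `(a, b)` with coordinates in `R` and nonsingular reduction is
`(ā, b̄)`. [folklore] -/
theorem reducePoint_some_algebraMap (hinj : Function.Injective (algebraMap R K))
    {a b : R} (h : (W.baseChange K).toAffine.Nonsingular (algebraMap R K a) (algebraMap R K b))
    (hns : (W.map (IsLocalRing.residue R)).toAffine.Nonsingular (IsLocalRing.residue R a)
        (IsLocalRing.residue R b)) :
    reducePoint W (.some _ _ h) = .some _ _ hns := by
  have hex : ∃ x₀ y₀ : R, algebraMap R K x₀ = algebraMap R K a ∧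
      algebraMap R K y₀ = algebraMap R K b ∧
      (W.map (IsLocalRing.residue R)).toAffine.Nonsingular (IsLocalRing.residue R x₀)
        (IsLocalRing.residue R y₀) := ⟨a, b, rfl, rfl, hns⟩
  rw [reducePoint, dif_pos hex, WeierstrassCurve.Affine.Point.some.injEq]
  exact ⟨by rw [hinj hex.choose_spec.choose_spec.1], by rw [hinj hex.choose_spec.choose_spec.2.1]⟩

/-- The reduction of a point with coordinates in `R` and singular reduction is the junk value `Õ`.
[folklore] -/
theorem reducePoint_some_algebraMap_of_not (hinj : Function.Injective (algebraMap R K))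
    {a b : R} (h : (W.baseChange K).toAffine.Nonsingular (algebraMap R K a) (algebraMap R K b))
    (hns : ¬ (W.map (IsLocalRing.residue R)).toAffine.Nonsingular (IsLocalRing.residue R a)
        (IsLocalRing.residue R b)) :
    reducePoint W (.some _ _ h) = 0 := by
  rw [reducePoint, dif_neg]
  rintro ⟨x₀, y₀, hx₀, hy₀, hns'⟩
  rw [hinj hx₀, hinj hy₀] at hns'
  exact hns hns'

/-! #### Negation -/

omit [IsLocalRing R] in
/-- `E₁(K)` is closed under negation. [cite: SilvermanAEC2009, VII.2 Prop. 2.1 (PDF p. 167)] -/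
theorem ReducesToZero.neg {P : (W.baseChange K).toAffine.Point}
    (hP : ReducesToZero W P) : ReducesToZero W (-P) := by
  rcases P with _ | ⟨x, y, h⟩
  · trivial
  · rw [WeierstrassCurve.Affine.Point.neg_some]; exact hP

/-- `E₀(K)` is closed under negation. [cite: SilvermanAEC2009, VII.2 Prop. 2.1 (PDF p. 167)] -/
theorem HasNonsingularReduction.neg {P : (W.baseChange K).toAffine.Point}
    (hP : HasNonsingularReduction W P) : HasNonsingularReduction W (-P) := by
  rcases P with _ | ⟨x, y, h⟩
  · trivial
  · rw [WeierstrassCurve.Affine.Point.neg_some]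
    rcases hP with hx | ⟨a, b, rfl, rfl, hns⟩
    · exact Or.inl hx
    · refine Or.inr ⟨a, W.toAffine.negY a b, rfl, (baseChange_negY_algebraMap a b).symm, ?_⟩
      rw [← map_residue_negY]
      exact (WeierstrassCurve.Affine.nonsingular_neg _ _).mpr hns

/-- Reduction commutes with negation: `(-P)~ = -P̃`.
[cite: SilvermanAEC2009, VII.2 Prop. 2.1 (PDF p. 167)] -/
theorem reducePoint_neg (hinj : Function.Injective (algebraMap R K))
    (P : (W.baseChange K).toAffine.Point) : reducePoint W (-P) = -reducePoint W P := by
  rcases P with _ | ⟨x, y, h⟩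
  · rfl
  · by_cases hx : x ∈ Set.range (algebraMap R K)
    · obtain ⟨a, rfl⟩ := hx
      -- `y` is then integral as well? Not needed: split on the existence of a lift of `y`.
      by_cases hy : y ∈ Set.range (algebraMap R K)
      · obtain ⟨b, rfl⟩ := hy
        have h' : (W.baseChange K).toAffine.Nonsingular (algebraMap R K a)
            (algebraMap R K (W.toAffine.negY a b)) := by
          rw [← baseChange_negY_algebraMap]
          exact (WeierstrassCurve.Affine.nonsingular_neg _ _).mpr h
        have hneg : -(WeierstrassCurve.Affine.Point.some _ _ h) = .some _ _ h' := by
          rw [WeierstrassCurve.Affine.Point.neg_some]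
          exact point_some_congr rfl (baseChange_negY_algebraMap a b)
        rw [hneg]
        by_cases hns : (W.map (IsLocalRing.residue R)).toAffine.Nonsingular
            (IsLocalRing.residue R a) (IsLocalRing.residue R b)
        · have hns' : (W.map (IsLocalRing.residue R)).toAffine.Nonsingular
              (IsLocalRing.residue R a) (IsLocalRing.residue R (W.toAffine.negY a b)) := by
            rw [← map_residue_negY]; exact (WeierstrassCurve.Affine.nonsingular_neg _ _).mpr hns
          rw [reducePoint_some_algebraMap hinj h hns, reducePoint_some_algebraMap hinj h' hns',
            WeierstrassCurve.Affine.Point.neg_some]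
          exact point_some_congr rfl (map_residue_negY a b).symm
        · have hns' : ¬ (W.map (IsLocalRing.residue R)).toAffine.Nonsingular
              (IsLocalRing.residue R a) (IsLocalRing.residue R (W.toAffine.negY a b)) := by
            rw [← map_residue_negY]
            exact fun h' ↦ hns ((WeierstrassCurve.Affine.nonsingular_neg _ _).mp h')
          rw [reducePoint_some_algebraMap_of_not hinj h hns,
            reducePoint_some_algebraMap_of_not hinj h' hns', neg_zero]
      · -- no lift of `y`: both sides are `0`
        have h0 : reducePoint W (.some _ _ h) = 0 := by
          rw [reducePoint, dif_neg]
          rintro ⟨x₀, y₀, -, hy₀, -⟩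
          exact hy ⟨y₀, hy₀⟩
        have h0' : reducePoint W (-(.some _ _ h)) = 0 := by
          rw [WeierstrassCurve.Affine.Point.neg_some, reducePoint, dif_neg]
          rintro ⟨x₀, y₀, hx₀, hy₀, -⟩
          apply hy
          refine ⟨-y₀ - W.a₁ * x₀ - W.a₃, ?_⟩
          have := congrArg (fun t ↦ -t - algebraMap R K W.a₁ * algebraMap R K a
            - algebraMap R K W.a₃) hy₀
          simp only [WeierstrassCurve.Affine.negY, WeierstrassCurve.baseChange,
            WeierstrassCurve.map_a₁, WeierstrassCurve.map_a₃] at this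
          simp only [map_sub, map_neg, map_mul, hx₀]
          rw [this]; ring
        rw [h0, h0', neg_zero]
    · rw [WeierstrassCurve.Affine.Point.neg_some, reducePoint_some_of_not_mem _ hx,
        reducePoint_some_of_not_mem _ hx, neg_zero]

end Definitions

/-! ### `E₁(K)` is a subgroup -/

section KernelGroup

variable {K : Type*} [Field K] {Γ₀ : Type*} [LinearOrderedCommGroupWithZero Γ₀]
  {v : Valuation K Γ₀} {R : Type*} [CommRing R] [IsLocalRing R] [Algebra R K]
  {W : WeierstrassCurve R}

omit [IsLocalRing R] in
/-- **`E₁(K)` is closed under addition** (Silverman, *AEC* VII.2.1 and VII.2.2: the kernel of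
reduction is a subgroup; here for a Weierstrass equation with coefficients in any valuation ring).
[cite: SilvermanAEC2009, VII.2 Prop. 2.1 (PDF p. 167)] -/
theorem ReducesToZero.add (hv : v.Integers R) {P Q : (W.baseChange K).toAffine.Point}
    (hP : ReducesToZero W P) (hQ : ReducesToZero W Q) :
    ReducesToZero W (P + Q) := by
  rcases P with _ | ⟨x₁, y₁, h₁⟩
  · rw [← WeierstrassCurve.Affine.Point.zero_def, zero_add]; exact hQ
  rcases Q with _ | ⟨x₂, y₂, h₂⟩
  · rw [← WeierstrassCurve.Affine.Point.zero_def, add_zero]; exact hP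
  rw [reducesToZero_some_iff, not_mem_range_iff hv] at hP hQ
  by_cases hxy : x₁ = x₂ ∧ y₁ = (W.baseChange K).toAffine.negY x₂ y₂
  · rw [WeierstrassCurve.Affine.Point.add_of_Y_eq hxy.1 hxy.2]; trivial
  · rw [WeierstrassCurve.Affine.Point.add_some hxy, reducesToZero_some_iff,
      not_mem_range_iff hv]
    exact one_lt_v_addX_of_one_lt hv h₁.1 h₂.1 hP hQ hxy

omit [IsLocalRing R] in
/-- `E₁(K)` is closed under subtraction. [cite: SilvermanAEC2009, VII.2 Prop. 2.1 (PDF p. 167)] -/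
theorem ReducesToZero.sub (hv : v.Integers R) {P Q : (W.baseChange K).toAffine.Point}
    (hP : ReducesToZero W P) (hQ : ReducesToZero W Q) :
    ReducesToZero W (P - Q) := by
  rw [sub_eq_add_neg]; exact hP.add hv hQ.neg

end KernelGroup

/-! ### Sums of points with integral coordinates -/

section Finite

variable {K : Type*} [Field K] {Γ₀ : Type*} [LinearOrderedCommGroupWithZero Γ₀]
  {v : Valuation K Γ₀} {R : Type*} [CommRing R] [IsLocalRing R] [Algebra R K]
  {W : WeierstrassCurve R}

/-- **Two points with integral coordinates and a lift of the slope** (Silverman, *AEC* VII.2.1,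
cases `P̃, Q̃ ≠ Õ`, `P̃ ≠ -Q̃`): if the slope of the line through `P = (a₁, b₁)` and `Q = (a₂, b₂)`
is (the image of) `L ∈ R` whose residue is the slope of the line through `P̃` and `Q̃` on `W̃`,
then `P + Q` has integral coordinates, nonsingular reduction, and `(P + Q)~ = P̃ + Q̃`.
[cite: SilvermanAEC2009, VII.2 Prop. 2.1 (PDF pp. 168–169)] -/
theorem exists_add_eq_of_lift (hinj : Function.Injective (algebraMap R K)) {a₁ b₁ a₂ b₂ L : R}
    (h₁ : (W.baseChange K).toAffine.Nonsingular (algebraMap R K a₁) (algebraMap R K b₁))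
    (h₂ : (W.baseChange K).toAffine.Nonsingular (algebraMap R K a₂) (algebraMap R K b₂))
    (hns₁ : (W.map (IsLocalRing.residue R)).toAffine.Nonsingular (IsLocalRing.residue R a₁)
      (IsLocalRing.residue R b₁))
    (hns₂ : (W.map (IsLocalRing.residue R)).toAffine.Nonsingular (IsLocalRing.residue R a₂)
      (IsLocalRing.residue R b₂))
    (hK : (W.baseChange K).toAffine.slope (algebraMap R K a₁) (algebraMap R K a₂)
      (algebraMap R K b₁) (algebraMap R K b₂) = algebraMap R K L)
    (hk : (W.map (IsLocalRing.residue R)).toAffine.slope (IsLocalRing.residue R a₁)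
      (IsLocalRing.residue R a₂) (IsLocalRing.residue R b₁) (IsLocalRing.residue R b₂) =
        IsLocalRing.residue R L)
    (hxyK : ¬(algebraMap R K a₁ = algebraMap R K a₂ ∧ algebraMap R K b₁ =
      (W.baseChange K).toAffine.negY (algebraMap R K a₂) (algebraMap R K b₂)))
    (hxyk : ¬(IsLocalRing.residue R a₁ = IsLocalRing.residue R a₂ ∧ IsLocalRing.residue R b₁ =
      (W.map (IsLocalRing.residue R)).toAffine.negY (IsLocalRing.residue R a₂)
        (IsLocalRing.residue R b₂))) :
    ∃ h₃ : (W.baseChange K).toAffine.Nonsingular (algebraMap R K (W.toAffine.addX a₁ a₂ L))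
        (algebraMap R K (W.toAffine.addY a₁ a₂ b₁ L)),
      WeierstrassCurve.Affine.Point.some _ _ h₁ + .some _ _ h₂ = .some _ _ h₃ ∧
      HasNonsingularReduction W (.some _ _ h₃) ∧
      reducePoint W (.some _ _ h₃) =
        reducePoint W (.some _ _ h₁) + reducePoint W (.some _ _ h₂) := by
  have cx : (W.baseChange K).toAffine.addX (algebraMap R K a₁) (algebraMap R K a₂)
      ((W.baseChange K).toAffine.slope (algebraMap R K a₁) (algebraMap R K a₂)
        (algebraMap R K b₁) (algebraMap R K b₂)) = algebraMap R K (W.toAffine.addX a₁ a₂ L) := by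
    rw [hK]; exact WeierstrassCurve.Affine.map_addX (algebraMap R K) a₁ a₂ L
  have cy : (W.baseChange K).toAffine.addY (algebraMap R K a₁) (algebraMap R K a₂)
      (algebraMap R K b₁) ((W.baseChange K).toAffine.slope (algebraMap R K a₁) (algebraMap R K a₂)
        (algebraMap R K b₁) (algebraMap R K b₂)) = algebraMap R K (W.toAffine.addY a₁ a₂ b₁ L) := by
    rw [hK]; exact WeierstrassCurve.Affine.map_addY (algebraMap R K) a₁ b₁ a₂ L
  have h₃ : (W.baseChange K).toAffine.Nonsingular (algebraMap R K (W.toAffine.addX a₁ a₂ L))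
      (algebraMap R K (W.toAffine.addY a₁ a₂ b₁ L)) := by
    rw [← cx, ← cy]; exact WeierstrassCurve.Affine.nonsingular_add h₁ h₂ hxyK
  have rx : (W.map (IsLocalRing.residue R)).toAffine.addX (IsLocalRing.residue R a₁)
      (IsLocalRing.residue R a₂) ((W.map (IsLocalRing.residue R)).toAffine.slope
        (IsLocalRing.residue R a₁) (IsLocalRing.residue R a₂) (IsLocalRing.residue R b₁)
        (IsLocalRing.residue R b₂)) = IsLocalRing.residue R (W.toAffine.addX a₁ a₂ L) := by
    rw [hk]; exact WeierstrassCurve.Affine.map_addX (IsLocalRing.residue R) a₁ a₂ L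
  have ry : (W.map (IsLocalRing.residue R)).toAffine.addY (IsLocalRing.residue R a₁)
      (IsLocalRing.residue R a₂) (IsLocalRing.residue R b₁)
      ((W.map (IsLocalRing.residue R)).toAffine.slope
        (IsLocalRing.residue R a₁) (IsLocalRing.residue R a₂) (IsLocalRing.residue R b₁)
        (IsLocalRing.residue R b₂)) = IsLocalRing.residue R (W.toAffine.addY a₁ a₂ b₁ L) := by
    rw [hk]; exact WeierstrassCurve.Affine.map_addY (IsLocalRing.residue R) a₁ b₁ a₂ L
  have hns₃ : (W.map (IsLocalRing.residue R)).toAffine.Nonsingular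
      (IsLocalRing.residue R (W.toAffine.addX a₁ a₂ L))
      (IsLocalRing.residue R (W.toAffine.addY a₁ a₂ b₁ L)) := by
    rw [← rx, ← ry]; exact WeierstrassCurve.Affine.nonsingular_add hns₁ hns₂ hxyk
  refine ⟨h₃, ?_, (hasNonsingularReduction_some_algebraMap_iff hinj h₃).mpr hns₃, ?_⟩
  · rw [WeierstrassCurve.Affine.Point.add_some hxyK]
    exact point_some_congr cx cy
  · rw [reducePoint_some_algebraMap hinj h₃ hns₃, reducePoint_some_algebraMap hinj h₁ hns₁,
      reducePoint_some_algebraMap hinj h₂ hns₂, WeierstrassCurve.Affine.Point.add_some hxyk]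
    exact point_some_congr rx.symm ry.symm

/-- **Case `x(P̃) ≠ x(Q̃)`** (Silverman, *AEC* VII.2.1, reduced points distinct and not opposite):
for `P = (a₁, b₁)`, `Q = (a₂, b₂)` with integral coordinates, nonsingular reductions and
`ā₁ ≠ ā₂`, the sum `P + Q` has integral coordinates, nonsingular reduction, and
`(P + Q)~ = P̃ + Q̃`. [cite: SilvermanAEC2009, VII.2 Prop. 2.1 (PDF p. 168)] -/
theorem exists_add_eq_of_residue_ne (hv : v.Integers R) {a₁ b₁ a₂ b₂ : R}
    (h₁ : (W.baseChange K).toAffine.Nonsingular (algebraMap R K a₁) (algebraMap R K b₁))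
    (h₂ : (W.baseChange K).toAffine.Nonsingular (algebraMap R K a₂) (algebraMap R K b₂))
    (hns₁ : (W.map (IsLocalRing.residue R)).toAffine.Nonsingular (IsLocalRing.residue R a₁)
      (IsLocalRing.residue R b₁))
    (hns₂ : (W.map (IsLocalRing.residue R)).toAffine.Nonsingular (IsLocalRing.residue R a₂)
      (IsLocalRing.residue R b₂))
    (hx : IsLocalRing.residue R a₁ ≠ IsLocalRing.residue R a₂) :
    ∃ (a₃ b₃ : R) (h₃ : (W.baseChange K).toAffine.Nonsingular (algebraMap R K a₃)
        (algebraMap R K b₃)),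
      WeierstrassCurve.Affine.Point.some _ _ h₁ + .some _ _ h₂ = .some _ _ h₃ ∧
      HasNonsingularReduction W (.some _ _ h₃) ∧
      reducePoint W (.some _ _ h₃) =
        reducePoint W (.some _ _ h₁) + reducePoint W (.some _ _ h₂) := by
  have hinj := hv.hom_inj
  have ha : a₁ ≠ a₂ := fun h ↦ hx (by rw [h])
  have hu : IsUnit (a₁ - a₂) := isUnit_of_residue_ne_zero (by rwa [map_sub, sub_ne_zero])
  set L := (b₁ - b₂) * ↑hu.unit⁻¹ with hL
  have hK : (W.baseChange K).toAffine.slope (algebraMap R K a₁) (algebraMap R K a₂)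
      (algebraMap R K b₁) (algebraMap R K b₂) = algebraMap R K L := by
    rw [baseChange_slope_eq_div_of_X_ne hinj ha, hL, map_mul, map_units_inv, IsUnit.unit_spec,
      div_eq_mul_inv]
  have hk : (W.map (IsLocalRing.residue R)).toAffine.slope (IsLocalRing.residue R a₁)
      (IsLocalRing.residue R a₂) (IsLocalRing.residue R b₁) (IsLocalRing.residue R b₂) =
        IsLocalRing.residue R L := by
    rw [WeierstrassCurve.Affine.slope_of_X_ne hx, hL, map_mul, map_units_inv, IsUnit.unit_spec,
      map_sub, map_sub, div_eq_mul_inv]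
  obtain ⟨h₃, hadd, hE₀, hred⟩ := exists_add_eq_of_lift hinj h₁ h₂ hns₁ hns₂ hK hk
    (fun h ↦ ha (hinj h.1)) (fun h ↦ hx h.1)
  exact ⟨_, _, h₃, hadd, hE₀, hred⟩

/-- **Case `P̃ = Q̃`, not of order `2`** (Silverman, *AEC* VII.2.1 with Lemma 2.1.1): for
`P = (a₁, b₁)`, `Q = (a₂, b₂)` with integral coordinates, nonsingular reductions, `ā₁ = ā₂` and
`b̄₁ ≠ -b̄₂ - ã₁ā₂ - ã₃` (so `P̃ = Q̃ ≠ -Q̃`), the slope of the line through `P, Q` is integral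
and reduces to the slope of the tangent line at `P̃`; hence `P + Q` has integral coordinates,
nonsingular reduction, and `(P + Q)~ = P̃ + Q̃ = 2P̃`.
[cite: SilvermanAEC2009, VII.2 Lemma 2.1.1 (PDF pp. 168–169)] -/
theorem exists_add_eq_of_residue_eq (hv : v.Integers R) {a₁ b₁ a₂ b₂ : R}
    (h₁ : (W.baseChange K).toAffine.Nonsingular (algebraMap R K a₁) (algebraMap R K b₁))
    (h₂ : (W.baseChange K).toAffine.Nonsingular (algebraMap R K a₂) (algebraMap R K b₂))
    (hns₁ : (W.map (IsLocalRing.residue R)).toAffine.Nonsingular (IsLocalRing.residue R a₁)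
      (IsLocalRing.residue R b₁))
    (hns₂ : (W.map (IsLocalRing.residue R)).toAffine.Nonsingular (IsLocalRing.residue R a₂)
      (IsLocalRing.residue R b₂))
    (hx : IsLocalRing.residue R a₁ = IsLocalRing.residue R a₂)
    (hy : IsLocalRing.residue R b₁ ≠ (W.map (IsLocalRing.residue R)).toAffine.negY
      (IsLocalRing.residue R a₂) (IsLocalRing.residue R b₂)) :
    ∃ (a₃ b₃ : R) (h₃ : (W.baseChange K).toAffine.Nonsingular (algebraMap R K a₃)
        (algebraMap R K b₃)),
      WeierstrassCurve.Affine.Point.some _ _ h₁ + .some _ _ h₂ = .some _ _ h₃ ∧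
      HasNonsingularReduction W (.some _ _ h₃) ∧
      reducePoint W (.some _ _ h₃) =
        reducePoint W (.some _ _ h₁) + reducePoint W (.some _ _ h₂) := by
  have hinj := hv.hom_inj
  have hyy : IsLocalRing.residue R b₁ = IsLocalRing.residue R b₂ :=
    WeierstrassCurve.Affine.Y_eq_of_Y_ne hns₁.1 hns₂.1 hx hy
  -- the `K`-points are not opposite
  have hxyK : ¬(algebraMap R K a₁ = algebraMap R K a₂ ∧ algebraMap R K b₁ =
      (W.baseChange K).toAffine.negY (algebraMap R K a₂) (algebraMap R K b₂)) := by
    rintro ⟨-, h⟩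
    rw [baseChange_negY_algebraMap] at h
    apply hy
    rw [hinj h, ← map_residue_negY]
  -- `D = b₁ + b₂ + a₁ x₁ + a₃` is a unit, `N` the numerator
  set D := b₁ + b₂ + W.a₁ * a₁ + W.a₃ with hD
  set N := a₁ ^ 2 + a₁ * a₂ + a₂ ^ 2 + W.a₂ * (a₁ + a₂) + W.a₄ - W.a₁ * b₂ with hN
  have hDres : IsLocalRing.residue R D = IsLocalRing.residue R b₁ -
      (W.map (IsLocalRing.residue R)).toAffine.negY (IsLocalRing.residue R a₂)
        (IsLocalRing.residue R b₂) := by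
    simp only [hD, map_add, map_mul, WeierstrassCurve.Affine.negY, WeierstrassCurve.map_a₁,
      WeierstrassCurve.map_a₃, hx]
    ring
  have hDu : IsUnit D := isUnit_of_residue_ne_zero (by rw [hDres]; exact sub_ne_zero.mpr hy)
  have hDK : algebraMap R K D ≠ 0 := (hDu.map (algebraMap R K)).ne_zero
  set L := N * ↑hDu.unit⁻¹ with hL
  have hLK : algebraMap R K L = algebraMap R K N / algebraMap R K D := by
    rw [hL, map_mul, map_units_inv, IsUnit.unit_spec, div_eq_mul_inv]
  have hLk : IsLocalRing.residue R L = IsLocalRing.residue R N / IsLocalRing.residue R D := by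
    rw [hL, map_mul, map_units_inv, IsUnit.unit_spec, div_eq_mul_inv]
  -- the slope over `K`
  have hK : (W.baseChange K).toAffine.slope (algebraMap R K a₁) (algebraMap R K a₂)
      (algebraMap R K b₁) (algebraMap R K b₂) = algebraMap R K L := by
    rw [hLK]
    by_cases hxa : algebraMap R K a₁ = algebraMap R K a₂
    · have ha : a₁ = a₂ := hinj hxa
      have hyK : algebraMap R K b₁ ≠
          (W.baseChange K).toAffine.negY (algebraMap R K a₂) (algebraMap R K b₂) :=
        fun h ↦ hxyK ⟨hxa, h⟩
      have hb : b₁ = b₂ := hinj (WeierstrassCurve.Affine.Y_eq_of_Y_ne h₁.1 h₂.1 hxa hyK)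
      subst ha hb
      rw [WeierstrassCurve.Affine.slope_of_Y_ne rfl hyK,
        div_eq_div_iff (sub_ne_zero.mpr (by exact hyK)) hDK]
      simp only [hN, hD, WeierstrassCurve.Affine.negY, baseChange_a₁, baseChange_a₂,
        baseChange_a₃, baseChange_a₄, map_add, map_sub, map_mul, map_pow]
      ring
    · rw [WeierstrassCurve.Affine.slope_of_X_ne hxa, div_eq_div_iff (sub_ne_zero.mpr hxa) hDK]
      have key := WeierstrassCurve.Affine.Y_sub_mul_eq_X_sub_mul (W.baseChange K).toAffine
        h₁.1 h₂.1
      simp only [baseChange_a₁, baseChange_a₂, baseChange_a₃, baseChange_a₄] at key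
      simp only [hN, hD, map_add, map_sub, map_mul, map_pow]
      linear_combination key
  -- the slope over the residue field
  have hk : (W.map (IsLocalRing.residue R)).toAffine.slope (IsLocalRing.residue R a₁)
      (IsLocalRing.residue R a₂) (IsLocalRing.residue R b₁) (IsLocalRing.residue R b₂) =
        IsLocalRing.residue R L := by
    have hyk : IsLocalRing.residue R b₁ - (W.map (IsLocalRing.residue R)).toAffine.negY
        (IsLocalRing.residue R a₁) (IsLocalRing.residue R b₁) ≠ 0 := by
      rw [hx, hyy, sub_ne_zero]; rwa [hyy] at hy
    rw [hLk, WeierstrassCurve.Affine.slope_of_Y_ne hx hy,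
      div_eq_div_iff hyk (by rw [hDres]; exact sub_ne_zero.mpr hy)]
    simp only [hN, hD, WeierstrassCurve.Affine.negY, WeierstrassCurve.map_a₁,
      WeierstrassCurve.map_a₂, WeierstrassCurve.map_a₃, WeierstrassCurve.map_a₄, map_add,
      map_sub, map_mul, map_pow, ← hx, ← hyy]
    ring
  obtain ⟨h₃, hadd, hE₀, hred⟩ :=
    exists_add_eq_of_lift hinj h₁ h₂ hns₁ hns₂ hK hk hxyK (fun h ↦ hy h.2)
  exact ⟨_, _, h₃, hadd, hE₀, hred⟩

/-- **Case `P̃ = -Q̃`** (Silverman, *AEC* VII.2.1, the remaining case of Exercise 7.15): for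
`P = (a₁, b₁)`, `Q = (a₂, b₂)` with integral coordinates, nonsingular reductions and
`P̃ = -Q̃`, the sum `P + Q` reduces to `O`.
[cite: SilvermanAEC2009, VII.2 Prop. 2.1 (PDF p. 168)] -/
theorem reducesToZero_add_of_residue_eq (hv : v.Integers R) {a₁ b₁ a₂ b₂ : R}
    (h₁ : (W.baseChange K).toAffine.Nonsingular (algebraMap R K a₁) (algebraMap R K b₁))
    (h₂ : (W.baseChange K).toAffine.Nonsingular (algebraMap R K a₂) (algebraMap R K b₂))
    (hns₁ : (W.map (IsLocalRing.residue R)).toAffine.Nonsingular (IsLocalRing.residue R a₁)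
      (IsLocalRing.residue R b₁))
    (hx : IsLocalRing.residue R a₁ = IsLocalRing.residue R a₂)
    (hy : IsLocalRing.residue R b₁ = (W.map (IsLocalRing.residue R)).toAffine.negY
      (IsLocalRing.residue R a₂) (IsLocalRing.residue R b₂)) :
    ReducesToZero W (WeierstrassCurve.Affine.Point.some _ _ h₁ + .some _ _ h₂) := by
  have hinj := hv.hom_inj
  have h1 := hv.map_le_one
  by_cases hxyK : algebraMap R K a₁ = algebraMap R K a₂ ∧ algebraMap R K b₁ =
      (W.baseChange K).toAffine.negY (algebraMap R K a₂) (algebraMap R K b₂)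
  · rw [WeierstrassCurve.Affine.Point.add_of_Y_eq hxyK.1 hxyK.2]; trivial
  rw [WeierstrassCurve.Affine.Point.add_some hxyK, reducesToZero_some_iff,
    not_mem_range_iff hv]
  refine one_lt_v_addX_of_one_lt_v_slope hv (h1 a₁) (h1 a₂) ?_
  -- it remains to see that the slope has valuation `> 1`
  by_cases hxa : algebraMap R K a₁ = algebraMap R K a₂
  · -- tangent at a point whose reduction has order `2`
    have ha : a₁ = a₂ := hinj hxa
    have hyK : algebraMap R K b₁ ≠
        (W.baseChange K).toAffine.negY (algebraMap R K a₂) (algebraMap R K b₂) :=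
      fun h ↦ hxyK ⟨hxa, h⟩
    have hb : b₁ = b₂ := hinj (WeierstrassCurve.Affine.Y_eq_of_Y_ne h₁.1 h₂.1 hxa hyK)
    subst ha hb
    set N₀ := 3 * a₁ ^ 2 + 2 * W.a₂ * a₁ + W.a₄ - W.a₁ * b₁ with hN₀
    set D₀ := b₁ - W.toAffine.negY a₁ b₁ with hD₀
    have hDK : algebraMap R K D₀ ≠ 0 := by
      rw [hD₀, map_sub, ← baseChange_negY_algebraMap]; exact sub_ne_zero.mpr hyK
    have hslope : (W.baseChange K).toAffine.slope (algebraMap R K a₁) (algebraMap R K a₁)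
        (algebraMap R K b₁) (algebraMap R K b₁) = algebraMap R K N₀ / algebraMap R K D₀ := by
      rw [WeierstrassCurve.Affine.slope_of_Y_ne rfl hyK,
        div_eq_div_iff (sub_ne_zero.mpr hyK) hDK]
      simp only [hN₀, hD₀, WeierstrassCurve.Affine.negY, baseChange_a₁, baseChange_a₂,
        baseChange_a₃, baseChange_a₄, map_add, map_sub, map_mul, map_pow, map_ofNat, map_neg]
    have hD0 : IsLocalRing.residue R D₀ = 0 := by
      rw [hD₀, map_sub, ← map_residue_negY]; exact sub_eq_zero.mpr hy
    have hN1 : v (algebraMap R K N₀) = 1 :=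
      (v_algebraMap_eq_one_iff hv N₀).mpr (residue_ne_zero_of_residue_eq_zero hns₁ hD0)
    have hDlt : v (algebraMap R K D₀) < 1 := (v_algebraMap_lt_one_iff hv D₀).mpr hD0
    have hDpos : 0 < v (algebraMap R K D₀) := by rw [Valuation.pos_iff]; exact hDK
    rw [hslope, map_div₀, hN1, lt_div_iff₀ hDpos, one_mul]
    exact hDlt
  · -- chord
    have hxlt : v (algebraMap R K a₁ - algebraMap R K a₂) < 1 := by
      rw [← map_sub, v_algebraMap_lt_one_iff hv, map_sub, hx, sub_self]
    have hxpos : 0 < v (algebraMap R K a₁ - algebraMap R K a₂) := by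
      rw [Valuation.pos_iff]; exact sub_ne_zero.mpr hxa
    rw [WeierstrassCurve.Affine.slope_of_X_ne hxa]
    by_cases hyb : IsLocalRing.residue R b₁ = IsLocalRing.residue R b₂
    · -- both reduce to the same point of order `2`
      set D := b₁ + b₂ + W.a₁ * a₁ + W.a₃ with hD
      set N := a₁ ^ 2 + a₁ * a₂ + a₂ ^ 2 + W.a₂ * (a₁ + a₂) + W.a₄ - W.a₁ * b₂ with hN
      have key : (algebraMap R K b₁ - algebraMap R K b₂) * algebraMap R K D =
          (algebraMap R K a₁ - algebraMap R K a₂) * algebraMap R K N := by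
        have := WeierstrassCurve.Affine.Y_sub_mul_eq_X_sub_mul (W.baseChange K).toAffine
          h₁.1 h₂.1
        simp only [baseChange_a₁, baseChange_a₂, baseChange_a₃, baseChange_a₄] at this
        simp only [hN, hD, map_add, map_sub, map_mul, map_pow]
        linear_combination this
      have hDres : IsLocalRing.residue R D =
          IsLocalRing.residue R (b₁ - W.toAffine.negY a₁ b₁) := by
        simp only [hD, map_add, map_sub, map_mul, map_neg, WeierstrassCurve.Affine.negY]
        rw [← hyb]; ring
      have hD0 : IsLocalRing.residue R D = 0 := by
        rw [hDres, map_sub, ← map_residue_negY, sub_eq_zero]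
        calc IsLocalRing.residue R b₁ = _ := hy
          _ = _ := by rw [← hx, ← hyb]
      have hNres : IsLocalRing.residue R N =
          IsLocalRing.residue R (3 * a₁ ^ 2 + 2 * W.a₂ * a₁ + W.a₄ - W.a₁ * b₁) := by
        simp only [hN, map_add, map_sub, map_mul, map_pow, map_ofNat, ← hx, ← hyb]
        ring
      have hN1 : v (algebraMap R K N) = 1 := by
        refine (v_algebraMap_eq_one_iff hv N).mpr ?_
        rw [hNres]
        exact residue_ne_zero_of_residue_eq_zero hns₁ (by rw [← hDres]; exact hD0)
      have hNK : algebraMap R K N ≠ 0 := by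
        intro h; rw [h, map_zero] at hN1; exact zero_ne_one hN1
      have hDK : algebraMap R K D ≠ 0 := by
        intro h
        rw [h, mul_zero, eq_comm, mul_eq_zero] at key
        exact key.elim (sub_ne_zero.mpr hxa) hNK
      have hDlt : v (algebraMap R K D) < 1 := (v_algebraMap_lt_one_iff hv D).mpr hD0
      have hDpos : 0 < v (algebraMap R K D) := by rw [Valuation.pos_iff]; exact hDK
      have hslope :
          (algebraMap R K b₁ - algebraMap R K b₂) / (algebraMap R K a₁ - algebraMap R K a₂) =
            algebraMap R K N / algebraMap R K D := by
        rw [div_eq_div_iff (sub_ne_zero.mpr hxa) hDK, key, mul_comm]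
      rw [hslope, map_div₀, hN1, lt_div_iff₀ hDpos, one_mul]
      exact hDlt
    · have hy1 : v (algebraMap R K b₁ - algebraMap R K b₂) = 1 := by
        rw [← map_sub, v_algebraMap_eq_one_iff hv, map_sub]
        exact sub_ne_zero.mpr hyb
      rw [map_div₀, hy1, lt_div_iff₀ hxpos, one_mul]
      exact hxlt

end Finite

/-! ### A point of `E₁(K)` plus a point with integral coordinates -/

section MixedPoints

variable {K : Type*} [Field K] {Γ₀ : Type*} [LinearOrderedCommGroupWithZero Γ₀]
  {v : Valuation K Γ₀} {R : Type*} [CommRing R] [IsLocalRing R] [Algebra R K]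
  {W : WeierstrassCurve R}

/-- If `P = (x₁, y₁)` reduces to `O` and `Q = (a₂, b₂)` has integral coordinates, then `P + Q` has
integral coordinates `(a₃, b₃)` with `ā₃ = ā₂` (Silverman, *AEC* VII.2.1, case `P̃ = Õ`).
[cite: SilvermanAEC2009, VII.2 Prop. 2.1 (PDF p. 168)] -/
theorem exists_add_eq_of_one_lt_aux (hv : v.Integers R) {x₁ y₁ : K} {a₂ b₂ : R}
    (h₁ : (W.baseChange K).toAffine.Nonsingular x₁ y₁) (hx₁ : 1 < v x₁)
    (h₂ : (W.baseChange K).toAffine.Nonsingular (algebraMap R K a₂) (algebraMap R K b₂)) :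
    ∃ (a₃ b₃ : R) (h₃ : (W.baseChange K).toAffine.Nonsingular (algebraMap R K a₃)
        (algebraMap R K b₃)),
      WeierstrassCurve.Affine.Point.some _ _ h₁ + .some _ _ h₂ = .some _ _ h₃ ∧
        IsLocalRing.residue R a₃ = IsLocalRing.residue R a₂ := by
  have hinj := hv.hom_inj
  have hx₂ : v (algebraMap R K a₂) ≤ 1 := hv.map_le_one a₂
  have hx : x₁ ≠ algebraMap R K a₂ := by rintro rfl; exact hx₂.not_gt hx₁
  have hsum := WeierstrassCurve.Affine.Point.add_of_X_ne (h₁ := h₁) (h₂ := h₂) hx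
  set x₃ := (W.baseChange K).toAffine.addX x₁ (algebraMap R K a₂)
    ((W.baseChange K).toAffine.slope x₁ (algebraMap R K a₂) y₁ (algebraMap R K b₂)) with hx₃
  set y₃ := (W.baseChange K).toAffine.addY x₁ (algebraMap R K a₂) y₁
    ((W.baseChange K).toAffine.slope x₁ (algebraMap R K a₂) y₁ (algebraMap R K b₂)) with hy₃
  have h₃ : (W.baseChange K).toAffine.Nonsingular x₃ y₃ :=
    WeierstrassCurve.Affine.nonsingular_add h₁ h₂ fun h ↦ hx h.1
  have hlt : v (x₃ - algebraMap R K a₂) < 1 := v_addX_sub_X_lt_one hv h₁.1 h₂.1 hx₁ hx₂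
  have hvx₃ : v x₃ ≤ 1 := by
    have : x₃ = (x₃ - algebraMap R K a₂) + algebraMap R K a₂ := by ring
    rw [this]; exact v.map_add_le hlt.le hx₂
  obtain ⟨a₃, ha₃⟩ := hv.exists_of_le_one hvx₃
  obtain ⟨b₃, hb₃⟩ := hv.exists_of_le_one (v_Y_le_one_of_v_X_le_one hv h₃.1 hvx₃)
  have h₃' : (W.baseChange K).toAffine.Nonsingular (algebraMap R K a₃) (algebraMap R K b₃) := by
    rw [ha₃, hb₃]; exact h₃
  refine ⟨a₃, b₃, h₃', hsum.trans (point_some_congr ha₃.symm hb₃.symm), ?_⟩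
  rw [← sub_eq_zero, ← map_sub, ← v_algebraMap_lt_one_iff hv, map_sub, ha₃]
  exact hlt

/-- **Case `P̃ = Õ ≠ Q̃`** (Silverman, *AEC* VII.2.1): if `P` reduces to `O` and `Q = (a₂, b₂)` has
integral coordinates and nonsingular reduction, then `P + Q` has integral coordinates,
nonsingular reduction, and `(P + Q)~ = Q̃ (= P̃ + Q̃)`.  The `x`-coordinate is read off from the
valuation estimate `exists_add_eq_of_one_lt_aux`; that the `y`-coordinate reduces to `b̄₂` rather
than
to `-b̄₂ - ã₁ā₂ - ã₃` is deduced from the group law: otherwise `(P + Q)~ = -Q̃`, so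
`(P + Q) + Q ∈ E₁(K)` by the case `P̃ = -Q̃`, hence `2Q = ((P + Q) + Q) - P ∈ E₁(K)`,
contradicting the case `P̃ = Q̃ ≠ -Q̃`. [cite: SilvermanAEC2009, VII.2 Prop. 2.1 (PDF p. 168)] -/
theorem exists_add_eq_of_one_lt (hv : v.Integers R) {x₁ y₁ : K} {a₂ b₂ : R}
    (h₁ : (W.baseChange K).toAffine.Nonsingular x₁ y₁) (hx₁ : 1 < v x₁)
    (h₂ : (W.baseChange K).toAffine.Nonsingular (algebraMap R K a₂) (algebraMap R K b₂))
    (hns₂ : (W.map (IsLocalRing.residue R)).toAffine.Nonsingular (IsLocalRing.residue R a₂)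
      (IsLocalRing.residue R b₂)) :
    ∃ (a₃ b₃ : R) (h₃ : (W.baseChange K).toAffine.Nonsingular (algebraMap R K a₃)
        (algebraMap R K b₃)),
      WeierstrassCurve.Affine.Point.some _ _ h₁ + .some _ _ h₂ = .some _ _ h₃ ∧
      HasNonsingularReduction W (.some _ _ h₃) ∧
      reducePoint W (.some _ _ h₃) = reducePoint W (.some _ _ h₂) := by
  have hinj := hv.hom_inj
  obtain ⟨a₃, b₃, h₃, hsum, ha⟩ := exists_add_eq_of_one_lt_aux hv h₁ hx₁ h₂
  -- the reduced point `(ā₃, b̄₃)` lies on `W̃` with `ā₃ = ā₂`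
  have heq₃ : (W.map (IsLocalRing.residue R)).toAffine.Equation (IsLocalRing.residue R a₃)
      (IsLocalRing.residue R b₃) :=
    ((map_equation_iff hinj).mp h₃.1).map (IsLocalRing.residue R)
  have hb : IsLocalRing.residue R b₃ = IsLocalRing.residue R b₂ ∨
      IsLocalRing.residue R b₃ = (W.map (IsLocalRing.residue R)).toAffine.negY
        (IsLocalRing.residue R a₂) (IsLocalRing.residue R b₂) :=
    WeierstrassCurve.Affine.Y_eq_of_X_eq heq₃ hns₂.1 ha
  -- the case `b̄₃ = b̄₂`
  have main : IsLocalRing.residue R b₃ = IsLocalRing.residue R b₂ := by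
    by_cases h2 : IsLocalRing.residue R b₂ = (W.map (IsLocalRing.residue R)).toAffine.negY
        (IsLocalRing.residue R a₂) (IsLocalRing.residue R b₂)
    · rcases hb with hb | hb
      · exact hb
      · exact hb.trans h2.symm
    rcases hb with hb | hb
    · exact hb
    -- `(P + Q)~ = -Q̃`: derive a contradiction
    exfalso
    have hns₃ : (W.map (IsLocalRing.residue R)).toAffine.Nonsingular (IsLocalRing.residue R a₃)
        (IsLocalRing.residue R b₃) := by
      rw [ha, hb]; exact (WeierstrassCurve.Affine.nonsingular_neg _ _).mpr hns₂
    -- `(P + Q) + Q ∈ E₁(K)`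
    have hker : ReducesToZero W (WeierstrassCurve.Affine.Point.some _ _ h₃ + .some _ _ h₂) :=
      reducesToZero_add_of_residue_eq hv h₃ h₂ hns₃ ha hb
    -- hence `2Q ∈ E₁(K)`
    have hP : ReducesToZero W (WeierstrassCurve.Affine.Point.some _ _ h₁) :=
      (reducesToZero_some_iff h₁).mpr ((not_mem_range_iff hv).mpr hx₁)
    have h2Q : ReducesToZero W
        (WeierstrassCurve.Affine.Point.some _ _ h₂ + .some _ _ h₂) := by
      have : WeierstrassCurve.Affine.Point.some _ _ h₂ + .some _ _ h₂ =
          (WeierstrassCurve.Affine.Point.some _ _ h₃ + .some _ _ h₂) - .some _ _ h₁ := by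
        rw [← hsum]; abel
      rw [this]; exact hker.sub hv hP
    -- but `2Q` has integral coordinates
    obtain ⟨a, b, h, hQQ, -, -⟩ := exists_add_eq_of_residue_eq hv h₂ h₂ hns₂ hns₂ rfl h2
    rw [hQQ, reducesToZero_some_iff] at h2Q
    exact h2Q ⟨a, rfl⟩
  have hns₃ : (W.map (IsLocalRing.residue R)).toAffine.Nonsingular (IsLocalRing.residue R a₃)
      (IsLocalRing.residue R b₃) := by rw [ha, main]; exact hns₂
  refine ⟨a₃, b₃, h₃, hsum, (hasNonsingularReduction_some_algebraMap_iff hinj h₃).mpr hns₃, ?_⟩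
  rw [reducePoint_some_algebraMap hinj h₃ hns₃, reducePoint_some_algebraMap hinj h₂ hns₂]
  exact point_some_congr ha main

end MixedPoints

/-! ### `E₀(K)` is a subgroup and reduction is a homomorphism -/

section Main

variable {K : Type*} [Field K] {Γ₀ : Type*} [LinearOrderedCommGroupWithZero Γ₀]
  {v : Valuation K Γ₀} {R : Type*} [CommRing R] [IsLocalRing R] [Algebra R K]
  {W : WeierstrassCurve R}

/-- Both claims of Silverman, *AEC* VII.2.1 at once, for two points of `E₀(K)`:
`P + Q ∈ E₀(K)` and `(P + Q)~ = P̃ + Q̃`.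
[cite: SilvermanAEC2009, VII.2 Prop. 2.1 (PDF pp. 167–169)] -/
theorem hasNonsingularReduction_add_and_reducePoint_add (hv : v.Integers R)
    {P Q : (W.baseChange K).toAffine.Point}
    (hP : HasNonsingularReduction W P) (hQ : HasNonsingularReduction W Q) :
    HasNonsingularReduction W (P + Q) ∧
      reducePoint W (P + Q) = reducePoint W P + reducePoint W Q := by
  have hinj := hv.hom_inj
  -- a point of `E₁` plus a point with integral coordinates
  have mixed : ∀ {x₁ y₁ : K} {a₂ b₂ : R} (h₁ : (W.baseChange K).toAffine.Nonsingular x₁ y₁)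
      (_ : 1 < v x₁)
      (h₂ : (W.baseChange K).toAffine.Nonsingular (algebraMap R K a₂) (algebraMap R K b₂))
      (_ : HasNonsingularReduction W (.some _ _ h₂)),
      HasNonsingularReduction W (WeierstrassCurve.Affine.Point.some _ _ h₁ + .some _ _ h₂) ∧
        reducePoint W (WeierstrassCurve.Affine.Point.some _ _ h₁ + .some _ _ h₂) =
          reducePoint W (.some _ _ h₁) + reducePoint W (.some _ _ h₂) := by
    intro x₁ y₁ a₂ b₂ h₁ hx₁ h₂ hQ
    have hns₂ := (hasNonsingularReduction_some_algebraMap_iff hinj h₂).mp hQ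
    obtain ⟨a₃, b₃, h₃, hsum, hE₀, hred⟩ := exists_add_eq_of_one_lt hv h₁ hx₁ h₂ hns₂
    rw [hsum, hred, reducePoint_some_of_not_mem h₁ ((not_mem_range_iff hv).mpr hx₁), zero_add]
    exact ⟨hE₀, rfl⟩
  rcases point_cases hv P with rfl | ⟨x₁, y₁, h₁, rfl, hx₁⟩ | ⟨a₁, b₁, h₁, rfl⟩
  · rw [zero_add, reducePoint_zero, zero_add]; exact ⟨hQ, rfl⟩
  · rcases point_cases hv Q with rfl | ⟨x₂, y₂, h₂, rfl, hx₂⟩ | ⟨a₂, b₂, h₂, rfl⟩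
    · rw [add_zero, reducePoint_zero, add_zero]; exact ⟨hP, rfl⟩
    · -- two points of `E₁`
      have hP' : ReducesToZero W (.some _ _ h₁) :=
        (reducesToZero_some_iff h₁).mpr ((not_mem_range_iff hv).mpr hx₁)
      have hQ' : ReducesToZero W (.some _ _ h₂) :=
        (reducesToZero_some_iff h₂).mpr ((not_mem_range_iff hv).mpr hx₂)
      refine ⟨(hP'.add hv hQ').hasNonsingularReduction, ?_⟩
      rw [(hP'.add hv hQ').reducePoint_eq_zero, hP'.reducePoint_eq_zero, hQ'.reducePoint_eq_zero,
        add_zero]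
    · exact mixed h₁ hx₁ h₂ hQ
  · rcases point_cases hv Q with rfl | ⟨x₂, y₂, h₂, rfl, hx₂⟩ | ⟨a₂, b₂, h₂, rfl⟩
    · rw [add_zero, reducePoint_zero, add_zero]; exact ⟨hP, rfl⟩
    · rw [add_comm, add_comm (reducePoint W _)]
      exact mixed h₂ hx₂ h₁ hP
    · -- two points with integral coordinates and nonsingular reductions
      have hns₁ := (hasNonsingularReduction_some_algebraMap_iff hinj h₁).mp hP
      have hns₂ := (hasNonsingularReduction_some_algebraMap_iff hinj h₂).mp hQ
      by_cases hx : IsLocalRing.residue R a₁ = IsLocalRing.residue R a₂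
      · by_cases hy : IsLocalRing.residue R b₁ = (W.map (IsLocalRing.residue R)).toAffine.negY
            (IsLocalRing.residue R a₂) (IsLocalRing.residue R b₂)
        · -- `P̃ = -Q̃`
          have hker := reducesToZero_add_of_residue_eq hv h₁ h₂ hns₁ hx hy
          refine ⟨hker.hasNonsingularReduction, ?_⟩
          rw [hker.reducePoint_eq_zero, reducePoint_some_algebraMap hinj h₁ hns₁,
            reducePoint_some_algebraMap hinj h₂ hns₂,
            WeierstrassCurve.Affine.Point.add_of_Y_eq hx hy]
        · obtain ⟨a₃, b₃, h₃, hsum, hE₀, hred⟩ :=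
            exists_add_eq_of_residue_eq hv h₁ h₂ hns₁ hns₂ hx hy
          rw [hsum]; exact ⟨hE₀, hred⟩
      · obtain ⟨a₃, b₃, h₃, hsum, hE₀, hred⟩ := exists_add_eq_of_residue_ne hv h₁ h₂ hns₁ hns₂ hx
        rw [hsum]; exact ⟨hE₀, hred⟩

/-- **`E₀(K)` is closed under addition** (Silverman, *AEC* VII.2.1: "`E₀(K)` is a subgroup of
`E(K)`"). [cite: SilvermanAEC2009, VII.2 Prop. 2.1 (PDF pp. 167–169)] -/
theorem HasNonsingularReduction.add (hv : v.Integers R) {P Q : (W.baseChange K).toAffine.Point}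
    (hP : HasNonsingularReduction W P) (hQ : HasNonsingularReduction W Q) :
    HasNonsingularReduction W (P + Q) :=
  (hasNonsingularReduction_add_and_reducePoint_add hv hP hQ).1

/-- **Reduction is a homomorphism on `E₀(K)`** (Silverman, *AEC* VII.2.1: "the reduction map
`E₀(K) → Ẽ_ns(k)` is a homomorphism").
[cite: SilvermanAEC2009, VII.2 Prop. 2.1 (PDF pp. 167–169)] -/
theorem reducePoint_add (hv : v.Integers R) {P Q : (W.baseChange K).toAffine.Point}
    (hP : HasNonsingularReduction W P) (hQ : HasNonsingularReduction W Q) :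
    reducePoint W (P + Q) = reducePoint W P + reducePoint W Q :=
  (hasNonsingularReduction_add_and_reducePoint_add hv hP hQ).2

/-- On `E₀(K)` the kernel of the reduction map is exactly `E₁(K)` (Silverman, *AEC* VII.2.1:
exactness of `0 → E₁(K) → E₀(K) → Ẽ_ns(k)`).
[cite: SilvermanAEC2009, VII.2 Prop. 2.1 (PDF p. 167)] -/
theorem reducePoint_eq_zero_iff (hv : v.Integers R) {P : (W.baseChange K).toAffine.Point}
    (hP : HasNonsingularReduction W P) :
    reducePoint W P = 0 ↔ ReducesToZero W P := by
  refine ⟨fun h ↦ ?_, fun h ↦ h.reducePoint_eq_zero⟩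
  rcases point_cases hv P with rfl | ⟨x, y, hxy, rfl, hx⟩ | ⟨a, b, hab, rfl⟩
  · trivial
  · exact (reducesToZero_some_iff hxy).mpr ((not_mem_range_iff hv).mpr hx)
  · have hns := (hasNonsingularReduction_some_algebraMap_iff hv.hom_inj hab).mp hP
    rw [reducePoint_some_algebraMap hv.hom_inj hab hns] at h
    exact (WeierstrassCurve.Affine.Point.some_ne_zero hns h).elim

variable (W)

/-- `E₁(K) ≤ E(K)`: the **kernel of reduction** as a subgroup of the Mordell–Weil group of
`W / K`, for a Weierstrass equation `W` with coefficients in a valuation ring `R` of `K`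
(`hv : v.Integers R`) (Silverman, *AEC* VII.2.1).
[cite: SilvermanAEC2009, VII.2 Prop. 2.1 (PDF p. 167)] -/
def kernelOfReduction (hv : v.Integers R) : AddSubgroup (W.baseChange K).toAffine.Point where
  carrier := {P | ReducesToZero W P}
  zero_mem' := (reducesToZero_zero : ReducesToZero W (0 : (W.baseChange K).toAffine.Point))
  add_mem' {P Q} (hP : ReducesToZero W P) (hQ : ReducesToZero W Q) :=
    hP.add hv hQ
  neg_mem' {P} (hP : ReducesToZero W P) := hP.neg

/-- `E₀(K) ≤ E(K)`: the subgroup of **points with nonsingular reduction**, for a Weierstrass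
equation `W` with coefficients in a valuation ring `R` of `K` (`hv : v.Integers R`)
(Silverman, *AEC* VII.2.1: "`E₀(K)` is a subgroup").
[cite: SilvermanAEC2009, VII.2 Prop. 2.1 (PDF p. 167)] -/
def nonsingularReductionSubgroup (hv : v.Integers R) :
    AddSubgroup (W.baseChange K).toAffine.Point where
  carrier := {P | HasNonsingularReduction W P}
  zero_mem' :=
    (hasNonsingularReduction_zero : HasNonsingularReduction W (0 : (W.baseChange K).toAffine.Point))
  add_mem' {P Q} (hP : HasNonsingularReduction W P) (hQ : HasNonsingularReduction W Q) :=
    hP.add hv hQ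
  neg_mem' {P} (hP : HasNonsingularReduction W P) := hP.neg

/-- The **reduction homomorphism** `E₀(K) →+ Ẽ_ns(k)`, `P ↦ P̃` (Silverman, *AEC* VII.2.1), with
values in Mathlib's group of nonsingular points of the reduced Weierstrass cubic
`W̃ = W.map (IsLocalRing.residue R)` (the group law on `Ẽ_ns(k)` of *AEC* III.2.5 is Mathlib's
`WeierstrassCurve.Affine.Point` instance, valid for singular cubics).
[cite: SilvermanAEC2009, VII.2 Prop. 2.1 (PDF p. 167)] -/
def reductionHom (hv : v.Integers R) :
    nonsingularReductionSubgroup W hv →+ (W.map (IsLocalRing.residue R)).toAffine.Point where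
  toFun P := reducePoint W (P : (W.baseChange K).toAffine.Point)
  map_zero' := reducePoint_zero
  map_add' P Q := reducePoint_add hv (P := (P : (W.baseChange K).toAffine.Point))
    (Q := (Q : (W.baseChange K).toAffine.Point)) P.2 Q.2

variable {W}

omit [IsLocalRing R] in
/-- Membership in `E₁(K)`. [folklore] -/
@[simp] theorem mem_kernelOfReduction_iff (hv : v.Integers R)
    {P : (W.baseChange K).toAffine.Point} :
    P ∈ kernelOfReduction W hv ↔ ReducesToZero W P := Iff.rfl

/-- Membership in `E₀(K)`. [folklore] -/
@[simp] theorem mem_nonsingularReductionSubgroup_iff (hv : v.Integers R)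
    {P : (W.baseChange K).toAffine.Point} :
    P ∈ nonsingularReductionSubgroup W hv ↔ HasNonsingularReduction W P := Iff.rfl

/-- The reduction homomorphism is `reducePoint`. [folklore] -/
@[simp] theorem reductionHom_apply (hv : v.Integers R) (P : nonsingularReductionSubgroup W hv) :
    reductionHom W hv P = reducePoint W (P : (W.baseChange K).toAffine.Point) := rfl

/-- `E₁(K) ≤ E₀(K)`. [cite: SilvermanAEC2009, VII.2 Prop. 2.1 (PDF p. 167)] -/
theorem kernelOfReduction_le_nonsingularReductionSubgroup (hv : v.Integers R) :
    kernelOfReduction W hv ≤ nonsingularReductionSubgroup W hv :=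
  fun _ (hP : ReducesToZero W _) ↦ hP.hasNonsingularReduction

/-- **Exactness at `E₀(K)`**: the kernel of the reduction homomorphism `E₀(K) → Ẽ_ns(k)` is
`E₁(K)` (Silverman, *AEC* VII.2.1). [cite: SilvermanAEC2009, VII.2 Prop. 2.1 (PDF p. 167)] -/
theorem reductionHom_ker (hv : v.Integers R) :
    (reductionHom W hv).ker =
      (kernelOfReduction W hv).addSubgroupOf (nonsingularReductionSubgroup W hv) := by
  ext P
  rw [AddMonoidHom.mem_ker, AddSubgroup.mem_addSubgroupOf, reductionHom_apply,
    mem_kernelOfReduction_iff]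
  exact reducePoint_eq_zero_iff hv P.2

end Main

/-! ### Bridge to `PointReduction.lean` -/

section PointReductionBridge

open scoped NNReal

universe u

variable {L : Type u} [Field L] {w : Valuation L ℝ≥0} (W : WeierstrassCurve w.integer)

/-- In the setting of `PointReduction.lean` (`w : Valuation L ℝ≥0`, `R = w.integer`): a point
other than `O` reduces to `O` iff it is not an integral point in the sense of
`Literature.NumberTheory.EllipticCurves.IsIntegralPoint`. [folklore] -/
theorem reducesToZero_iff_not_isIntegralPoint {P : (W.baseChange L).toAffine.Point} (hP : P ≠ 0) :
    W.ReducesToZero P ↔ ¬ Literature.NumberTheory.EllipticCurves.IsIntegralPoint w P := by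
  rcases P with _ | ⟨x, y, h⟩
  · exact (hP rfl).elim
  · rw [reducesToZero_some_iff, Literature.NumberTheory.EllipticCurves.not_mem_range_iff (Valuation.integer.integers w),
      Literature.NumberTheory.EllipticCurves.isIntegralPoint_some_iff, not_le]

/-- `E₁(L)` versus `Literature.NumberTheory.EllipticCurves.IsIntegralPoint`: `P ∈ E₁(L)` iff `P = O` or `P` is not integral.
[folklore] -/
theorem reducesToZero_iff_eq_zero_or_not_isIntegralPoint (P : (W.baseChange L).toAffine.Point) :
    W.ReducesToZero P ↔ P = 0 ∨ ¬ Literature.NumberTheory.EllipticCurves.IsIntegralPoint w P := by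
  by_cases hP : P = 0
  · subst hP; simp
  · rw [reducesToZero_iff_not_isIntegralPoint W hP, or_iff_right hP]

/-- The reduction map `Literature.reducePoint w r Ṽ` of `PointReduction.lean`, for `r` the residue map of
`w.integer` and `Ṽ = W.map r` the reduced equation, agrees with `WeierstrassCurve.reducePoint` on
every point (no good-reduction hypothesis is needed for this). [folklore] -/
theorem reducePoint_eq_reducePoint (P : (W.baseChange L).toAffine.Point) :
    Literature.NumberTheory.EllipticCurves.reducePoint w (IsLocalRing.residue w.integer) (W.map (IsLocalRing.residue w.integer)) P =
      W.reducePoint P := by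
  have hv := Valuation.integer.integers w
  rcases P with _ | ⟨x, y, h⟩
  · rfl
  by_cases hx : w x ≤ 1
  · have hy : w y ≤ 1 := Literature.NumberTheory.EllipticCurves.v_Y_le_one_of_v_X_le_one hv h.1 hx
    -- view the coordinates as images of elements of `w.integer`
    have h' : (W.baseChange L).toAffine.Nonsingular (algebraMap w.integer L ⟨x, hx⟩)
        (algebraMap w.integer L ⟨y, hy⟩) := h
    change _ = W.reducePoint (.some _ _ h')
    by_cases hns : (W.map (IsLocalRing.residue w.integer)).toAffine.Nonsingular
        (IsLocalRing.residue w.integer ⟨x, hx⟩) (IsLocalRing.residue w.integer ⟨y, hy⟩)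
    · rw [reducePoint_some_algebraMap hv.hom_inj h' hns]
      have hns' : (W.map (IsLocalRing.residue w.integer)).toAffine.Nonsingular
          (Literature.NumberTheory.EllipticCurves.reduceFun (IsLocalRing.residue w.integer) x)
          (Literature.NumberTheory.EllipticCurves.reduceFun (IsLocalRing.residue w.integer) y) := by
        rwa [Literature.NumberTheory.EllipticCurves.reduceFun_of_le _ hx, Literature.NumberTheory.EllipticCurves.reduceFun_of_le _ hy]
      have : Literature.NumberTheory.EllipticCurves.reducePoint w (IsLocalRing.residue w.integer)
          (W.map (IsLocalRing.residue w.integer)) (.some x y h) = .some _ _ hns' := by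
        simp only [Literature.NumberTheory.EllipticCurves.reducePoint, hx, hns', and_self, ↓reduceDIte]
      rw [this]
      exact Literature.NumberTheory.EllipticCurves.point_some_congr (Literature.NumberTheory.EllipticCurves.reduceFun_of_le _ hx) (Literature.NumberTheory.EllipticCurves.reduceFun_of_le _ hy)
    · rw [reducePoint_some_algebraMap_of_not hv.hom_inj h' hns]
      have hns' : ¬ (W.map (IsLocalRing.residue w.integer)).toAffine.Nonsingular
          (Literature.NumberTheory.EllipticCurves.reduceFun (IsLocalRing.residue w.integer) x)
          (Literature.NumberTheory.EllipticCurves.reduceFun (IsLocalRing.residue w.integer) y) := by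
        rwa [Literature.NumberTheory.EllipticCurves.reduceFun_of_le _ hx, Literature.NumberTheory.EllipticCurves.reduceFun_of_le _ hy]
      simp only [Literature.NumberTheory.EllipticCurves.reducePoint, hns', and_false, ↓reduceDIte]
  · rw [Literature.NumberTheory.EllipticCurves.reducePoint_some_of_one_lt (not_le.mp hx),
      reducePoint_some_of_not_mem h ((Literature.NumberTheory.EllipticCurves.not_mem_range_iff hv).mpr (not_le.mp hx))]

end PointReductionBridge

end WeierstrassCurve
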